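import Literature.NumberTheory.Sieve.GrimmeltMerikoski2025HeegnerBridge
import Literature.NumberTheory.Sieve.GrimmeltMerikoski2025TypeIPoissonRange
import HarnessLib

/-!
# Grimmelt–Merikoski 2025, Theorem 1.4 (restricted range) from the hypothesis schema of Theorem 2.1

L. Grimmelt, J. Merikoski, *On the greatest prime factor and uniform equidistribution of quadratic
polynomials*, arXiv:2505.00493 [GrimmeltMerikoski2025], §5 (Proof of Theorem 1.4).

**Main result (PROVED):** `GM2025.thm14_restricted_of_technicalDatum :
  TechnicalDatum (7/64) → grimmeltMerikoski2025_thm14_restricted`.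

The named fact `Literature.NumberTheory.Sieve.grimmeltMerikoski2025_thm14_restricted`
(`GrimmeltMerikoski2025Restricted.lean`) is Theorem 1.4 of the paper in the range `K ≤ D X^{1+δ}`.
Its only non-elementary input is [GrimmeltMerikoski2025, Theorem 2.1] ("Theorem 8.1 in
[GMtechnical]", automorphic spectral theory of `Γ₀(q)∖SL₂(ℝ)` with the Kim–Sarnak bound
`θ ≤ 7/64`), which the tree does not have; it is isolated as the hypothesis schema
`GM2025.TechnicalDatum θ` of `GrimmeltMerikoski2025Technical.lean` (a structure, data + bound, in the
manner of `Literature.NumberTheory.Automorphic.SpectralDatum`).  This file carries out the whole of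
§5 of the paper from that schema:

1. the Poisson range `K ≤ X^{1−η}` (`grimmeltMerikoski2025_thm14_poissonRange`);
2. otherwise `X₂ = K^{1/(1−η)} > X` (`X2_facts`) and the reduction to the difference of the smoothed
   sums at the scales `X`, `X₂` (`typeISum_le_diffForm_add`, Poisson remainder `poissonErr_le_one`);
3. normalisation `Ψᵢ = ψᵢ/X^δ` (`isDeltaWeight_div`), Lemma 3.1 (`sum_forms_eq_sum_heegPairs`) and the
   cancelling main terms (`integral_skewTestFun_xStretch`): `diffTerm_le`;
4. Theorem 2.1 (`TechnicalDatum.bound`) for each `d ≤ D` with `Z₁ = D`, `Z₂ = 1 + D/√(ah)`,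
   `Z₀ = max(1, (2𝐗/𝐘+1)/(Z₁Z₂))`, `δ₀ = X^{−δ}/2`, and Cauchy–Schwarz in `d` (`sum_errors_le`);
5. `K₁ ≤ ∑_{q ≤ aD} ⟨I|𝒦_q k⁺|I⟩ ≺≺ D(1+𝐗) + 𝐗⁻¹ + Z₁` (Proposition 4.2: `sum_K1_le`,
   `exists_sum_kernelDiagSum_le`) and `K₂ ≤ ∑_{q ≤ aD} ⟨α_q|𝒦_q k⁺|α_q⟩ ≺≺ D h^{1/2} + h Z₂`
   (Proposition 4.1: `sum_K2_le`, `kernelSide_le`, `heegnerKernel_sum_le`);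
6. the exponent bookkeeping (`K1_bookkeeping`, `K2_bookkeeping`, `r_bookkeeping`,
   `product_bookkeeping`, `final_arith`): with `ε₁ = min(ε,1)/64` all losses are `X^{26ε₁} ≤ X^ε`.

## References

* [GrimmeltMerikoski2025] L. Grimmelt, J. Merikoski, arXiv:2505.00493, §5 and Theorem 2.1.
* [GMtechnical] L. Grimmelt, J. Merikoski, *Weighted averages of SL₂(ℝ) automorphic kernel, part i:
  non-oscillatory functions* (2025), Theorem 8.1 — as cited in [GrimmeltMerikoski2025, §2].
-/

noncomputable section

namespace Literature.NumberTheory.Sieve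

open UpperHalfPlane MeasureTheory Finset
open Literature.NumberTheory.Automorphic (pointPairInv automorphicKernel)
open Literature.NumberTheory.Sieve.DFI1995 (Gamma0GL)
open Literature.NumberTheory.QuadraticFields.Quadratic (BinQF)
open scoped MatrixGroups ContDiff

namespace GM2025


/-! ## Part 6: assembly — Theorem 1.4 (restricted range) from the hypothesis schema

[GrimmeltMerikoski2025, §5].  Normalisation `Ψᵢ = ψᵢ / X^δ` (so that `IsDeltaWeight` holds with
any `δ₀ ≤ 1`), the smoothed sums as weighted orbit sums (Part 3), cancellation of the main terms
(Part 4), Theorem 2.1 (= `TechnicalDatum.bound`) for each `d`, Cauchy–Schwarz in `d`, and the two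
kernel estimates: Proposition 4.2 in the form `exists_sum_kernelDiagSum_le` (via
`automorphicKernel_iPt_eq_kernelDiagSum`) and Proposition 4.1 in the form `heegnerKernel_sum_le`
(via `kernelSide_le`). -/

section weights

/-- Fewer derivatives is weaker. [folklore] -/
theorem IsAdmissibleWeight.of_le {ψ : ℝ → ℂ} {lo hi : ℝ} {J J' : ℕ} {B : ℝ}
    (hψ : IsAdmissibleWeight ψ lo hi J B) (hJ : J' ≤ J) : IsAdmissibleWeight ψ lo hi J' B :=
  ⟨hψ.1, hψ.2.1, fun j hj u => hψ.2.2 j (hj.trans hJ) u⟩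

/-- Reflection `u ↦ ψ(−u)` of a weight on `[−1, 1]`. [folklore] -/
theorem IsAdmissibleWeight.comp_neg {ψ : ℝ → ℂ} {J : ℕ} {B : ℝ}
    (hψ : IsAdmissibleWeight ψ (-1) 1 J B) : IsAdmissibleWeight (fun u => ψ (-u)) (-1) 1 J B := by
  refine ⟨hψ.1.comp contDiff_neg, fun u hu => ?_, fun j hj u => ?_⟩
  · have := hψ.2.1 (-u) hu
    constructor <;> linarith [this.1, this.2]
  · rw [iteratedDeriv_comp_neg, norm_smul, norm_pow, norm_neg, norm_one, one_pow, one_mul]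
    exact hψ.2.2 j hj (-u)

/-- **Normalisation**: `Ψ = ψ/B` is a `δ₀`-weight for every `δ₀ ∈ (0, 1]` (`|Ψ^{(j)}| ≤ 1 ≤ δ₀^{-j}`).
[cite: GrimmeltMerikoski2025, §5 ("we apply Theorem 2.1 with δ^{-1} ≺≺ 1")] -/
theorem isDeltaWeight_div {ψ : ℝ → ℂ} {lo hi : ℝ} {J : ℕ} {B : ℝ} (hψ : IsAdmissibleWeight ψ lo hi J B)
    (hB : 0 < B) {δ₀ : ℝ} (hδ₀ : 0 < δ₀) (hδ₁ : δ₀ ≤ 1) :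
    IsDeltaWeight (fun u => ψ u / (B : ℂ)) lo hi J δ₀ := by
  refine ⟨hψ.1.div_const _, fun u hu => hψ.2.1 u ?_, fun j hj u => ?_⟩
  · intro h0; apply hu; simp [h0]
  · rw [iteratedDeriv_div_const, norm_div, Complex.norm_real, Real.norm_eq_abs, abs_of_pos hB,
      div_le_iff₀ hB]
    calc ‖iteratedDeriv j ψ u‖ ≤ B := hψ.2.2 j hj u
      _ = 1 * B := (one_mul B).symm
      _ ≤ δ₀ ^ (-(j : ℝ)) * B := by
          refine mul_le_mul_of_nonneg_right ?_ hB.le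
          exact Real.one_le_rpow_of_pos_of_le_one_of_nonpos hδ₀ hδ₁ (by simp)

/-- `rootSum` is linear in the weight: `rootSum (ψ/B) = rootSum ψ / B`. [folklore] -/
theorem rootSum_div (a h k : ℕ) (ψ : ℝ → ℂ) (B : ℂ) (X : ℝ) :
    rootSum a h k (fun u => ψ u / B) X = rootSum a h k ψ X / B := by
  unfold rootSum; rw [sum_div]

end weights

section perModulus

open RootForms
open Literature.NumberTheory.Automorphic (automorphicKernel)

variable {a h d : ℕ}

/-- Fibre summation: `∑_p b_p F(w_p) = ∑_{w ∈ S} (∑_{p : w_p = w} b_p) F(w)`. [folklore] -/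
theorem sum_heegPairs_fiber [DecidableEq ℍ] (F : ℍ → ℂ) :
    ∑ p ∈ heegPairs a h d, (pairWt p : ℂ) * F (pairPt p) =
      ∑ w ∈ (heegPairs a h d).image pairPt,
        ((∑ p ∈ (heegPairs a h d).filter (fun p => pairPt p = w), pairWt p : ℝ) : ℂ) * F w := by
  rw [← sum_fiberwise_of_maps_to (g := pairPt) (fun p hp => mem_image_of_mem pairPt hp)]
  refine sum_congr rfl fun w _ => ?_
  rw [Complex.ofReal_sum, sum_mul]
  refine sum_congr rfl fun p hp => ?_
  rw [(mem_filter.mp hp).2]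

/-- The same for the real double sum of the kernel. [folklore] -/
theorem sum_heegPairs_fiber₂ [DecidableEq ℍ] (G : ℍ → ℍ → ℝ) :
    ∑ w ∈ (heegPairs a h d).image pairPt, ∑ w' ∈ (heegPairs a h d).image pairPt,
        (∑ p ∈ (heegPairs a h d).filter (fun p => pairPt p = w), pairWt p) *
          (∑ p' ∈ (heegPairs a h d).filter (fun p' => pairPt p' = w'), pairWt p') * G w' w =
      ∑ p ∈ heegPairs a h d, ∑ p' ∈ heegPairs a h d, pairWt p * pairWt p' * G (pairPt p') (pairPt p) := by
  symm
  rw [← sum_fiberwise_of_maps_to (g := pairPt) (fun p hp => mem_image_of_mem pairPt hp)]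
  refine sum_congr rfl fun w _ => ?_
  -- inner: fix the fibre over `w`
  have inner : ∀ p ∈ (heegPairs a h d).filter (fun p => pairPt p = w),
      ∑ p' ∈ heegPairs a h d, pairWt p * pairWt p' * G (pairPt p') (pairPt p) =
        pairWt p * ∑ w' ∈ (heegPairs a h d).image pairPt,
          (∑ p' ∈ (heegPairs a h d).filter (fun p' => pairPt p' = w'), pairWt p') * G w' w := by
    intro p hp
    rw [(mem_filter.mp hp).2, mul_sum,
      ← sum_fiberwise_of_maps_to (g := pairPt) (fun p' hp' => mem_image_of_mem pairPt hp')]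
    refine sum_congr rfl fun w' _ => ?_
    rw [sum_mul, mul_sum]
    refine sum_congr rfl fun p' hp' => ?_
    rw [(mem_filter.mp hp').2]; ring
  rw [sum_congr rfl inner, ← sum_mul, mul_sum]
  refine sum_congr rfl fun w' _ => ?_
  ring

/-- **The `d`-th term of the difference form through the schema's error terms.**  With
`Φ_j = skewTestFun Ψ₁ (Ψ₂(−·)) (X_j/K) (√(ah)/(aK))`, `c = X/X₂`, the Heegner data `(S, b)` of
`heegPairs a h d` and ANY real `m` (the main terms cancel: `∫Φ₁ = c ∫Φ₂`):
`‖∑_{k ≡ 0 (d)} Ψ₁(k/K)(rootSum Ψ₂ X − c·rootSum Ψ₂ X₂)‖ ≤ ‖T₁‖ + c‖T₂‖`,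
`T_j = ∑_{w ∈ S} b_w (orbitSum Γ₀(ad) Φ_j w − m ∫Φ_j)`.
[cite: GrimmeltMerikoski2025, §5 ("By Lemma 3.1 and by inserting the corresponding integrals … which match exactly")] -/
theorem diffTerm_le [DecidableEq ℍ] (ha : 0 < a) (hh : 0 < h) [NeZero (a * d)] (Ψ₁ Ψ₂ : ℝ → ℂ)
    (hΨ₁ : ∀ u, Ψ₁ u ≠ 0 → 1 ≤ u ∧ u ≤ 2) (hΨ₂ : ∀ u, Ψ₂ u ≠ 0 → -1 ≤ u ∧ u ≤ 1)
    {K X X₂ : ℝ} (hK : 0 < K) (hX : 0 < X) (hX₂ : 0 < X₂) (m : ℝ) :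
    let Φ : ℝ → ℍ → ℂ := fun Xj => skewTestFun Ψ₁ (fun s => Ψ₂ (-s)) (Xj / K)
      (Real.sqrt ((a * h : ℕ) : ℝ) / (a * K))
    let S := (heegPairs a h d).image pairPt
    let b : ℍ → ℝ := fun w => ∑ p ∈ (heegPairs a h d).filter (fun p => pairPt p = w), pairWt p
    let T : ℝ → ℂ := fun Xj => ∑ w ∈ S, (b w : ℂ) *
      (orbitSum (Gamma0GL (a * d)) (Φ Xj) w - (m : ℂ) * ∫ z : ℍ, Φ Xj z)
    ‖∑ k ∈ (Icc 1 ⌊2 * K⌋₊).filter (fun k : ℕ => d ∣ k),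
        Ψ₁ ((k : ℝ) / K) * (rootSum a h k Ψ₂ X - ((X / X₂ : ℝ) : ℂ) * rootSum a h k Ψ₂ X₂)‖ ≤
      ‖T X‖ + (X / X₂) * ‖T X₂‖ := by
  intro Φ S b T
  have hNk : ∀ k : ℕ, (k : ℝ) ≤ 2 * K → k ≤ ⌊2 * K⌋₊ := fun k hk => Nat.le_floor hk
  -- the two smoothed sums as weighted orbit sums
  have hL2 : ∀ Xj : ℝ, 0 < Xj → ∑ k ∈ (Icc 1 ⌊2 * K⌋₊).filter (fun k : ℕ => d ∣ k),
      Ψ₁ ((k : ℝ) / K) * rootSum a h k Ψ₂ Xj = ∑ w ∈ S, (b w : ℂ) * orbitSum (Gamma0GL (a * d)) (Φ Xj) w := by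
    intro Xj hXj
    rw [sum_rootSum_eq_sum_forms ha h d ⌊2 * K⌋₊ Ψ₁ Ψ₂ hK hXj,
      sum_forms_eq_sum_heegPairs ha hh Ψ₁ Ψ₂ hΨ₁ hΨ₂ hK hXj hNk]
    exact sum_heegPairs_fiber (a := a) (h := h) (d := d) _
  -- the main terms cancel
  have hc : 0 < X / X₂ := div_pos hX hX₂
  have hmain : ∫ z : ℍ, Φ X z = ((X / X₂ : ℝ) : ℂ) * ∫ z : ℍ, Φ X₂ z := by
    have e : X / K = (X / X₂) * (X₂ / K) := by field_simp
    show ∫ z : ℍ, skewTestFun Ψ₁ (fun s => Ψ₂ (-s)) (X / K) _ z = _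
    rw [e]
    exact integral_skewTestFun_xStretch Ψ₁ _ (X₂ / K) _ hc
  have hsplit : ∑ k ∈ (Icc 1 ⌊2 * K⌋₊).filter (fun k : ℕ => d ∣ k),
      Ψ₁ ((k : ℝ) / K) * (rootSum a h k Ψ₂ X - ((X / X₂ : ℝ) : ℂ) * rootSum a h k Ψ₂ X₂) =
      T X - ((X / X₂ : ℝ) : ℂ) * T X₂ := by
    have e1 : ∑ k ∈ (Icc 1 ⌊2 * K⌋₊).filter (fun k : ℕ => d ∣ k),
        Ψ₁ ((k : ℝ) / K) * (rootSum a h k Ψ₂ X - ((X / X₂ : ℝ) : ℂ) * rootSum a h k Ψ₂ X₂) =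
        (∑ k ∈ (Icc 1 ⌊2 * K⌋₊).filter (fun k : ℕ => d ∣ k), Ψ₁ ((k : ℝ) / K) * rootSum a h k Ψ₂ X) -
        ((X / X₂ : ℝ) : ℂ) * ∑ k ∈ (Icc 1 ⌊2 * K⌋₊).filter (fun k : ℕ => d ∣ k),
          Ψ₁ ((k : ℝ) / K) * rootSum a h k Ψ₂ X₂ := by
      rw [mul_sum, ← sum_sub_distrib]
      refine sum_congr rfl fun k _ => ?_; ring
    rw [e1, hL2 X hX, hL2 X₂ hX₂]
    have eT : ∀ Xj : ℝ, T Xj = (∑ w ∈ S, (b w : ℂ) * orbitSum (Gamma0GL (a * d)) (Φ Xj) w) -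
        (m : ℂ) * (∫ z : ℍ, Φ Xj z) * ∑ w ∈ S, (b w : ℂ) := by
      intro Xj
      simp only [T, mul_sub, sum_sub_distrib, mul_sum]
      congr 1
      refine sum_congr rfl fun w _ => ?_; ring
    rw [eT, eT, hmain]; ring
  rw [hsplit]
  calc ‖T X - ((X / X₂ : ℝ) : ℂ) * T X₂‖ ≤ ‖T X‖ + ‖((X / X₂ : ℝ) : ℂ) * T X₂‖ := norm_sub_le _ _
    _ = ‖T X‖ + (X / X₂) * ‖T X₂‖ := by
        rw [norm_mul, Complex.norm_real, Real.norm_eq_abs, abs_of_pos hc]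

/-- The weights `b_w` of the Heegner data are non-negative. [folklore] -/
theorem fiberWt_nonneg [DecidableEq ℍ] (w : ℍ) :
    0 ≤ ∑ p ∈ (heegPairs a h d).filter (fun p => pairPt p = w), pairWt p :=
  sum_nonneg fun p _ => pairWt_nonneg p

end perModulus

section sumOverModuli

open RootForms
open Literature.NumberTheory.Automorphic (pointPairInv automorphicKernel)

/-- Reflection of a `δ`-weight on `[−1, 1]`. [folklore] -/
theorem IsDeltaWeight.comp_neg {Ψ : ℝ → ℂ} {J : ℕ} {δ : ℝ}
    (hΨ : IsDeltaWeight Ψ (-1) 1 J δ) : IsDeltaWeight (fun u => Ψ (-u)) (-1) 1 J δ := by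
  refine ⟨hΨ.1.comp contDiff_neg, fun u hu => ?_, fun j hj u => ?_⟩
  · have := hΨ.2.1 (-u) hu
    constructor <;> linarith [this.1, this.2]
  · rw [iteratedDeriv_comp_neg, norm_smul, norm_pow, norm_neg, norm_one, one_pow, one_mul]
    exact hΨ.2.2 j hj (-u)

/-- The automorphic kernel of a non-negative kernel is non-negative. [folklore] -/
theorem automorphicKernel_nonneg (Γ : Subgroup (GL (Fin 2) ℝ)) {k : ℝ → ℝ} (hk : ∀ u, 0 ≤ k u)
    (z w : ℍ) : 0 ≤ automorphicKernel Γ k z w := by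
  unfold automorphicKernel
  exact finsum_nonneg fun γ => finsum_nonneg fun _ => hk _

/-- **Cauchy–Schwarz in `d`**: `∑_d P √x_d √y_d ≤ P √(∑ x_d) √(∑ y_d)` for `x, y ≥ 0`, `P ≥ 0`. [folklore] -/
theorem sum_mul_sqrt_mul_sqrt_le {ι : Type*} (s : Finset ι) {P : ℝ} (hP : 0 ≤ P) {x y : ι → ℝ}
    (hx : ∀ i ∈ s, 0 ≤ x i) (hy : ∀ i ∈ s, 0 ≤ y i) :
    ∑ i ∈ s, P * Real.sqrt (x i) * Real.sqrt (y i) ≤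
      P * Real.sqrt (∑ i ∈ s, x i) * Real.sqrt (∑ i ∈ s, y i) := by
  have hcs := sum_mul_sq_le_sq_mul_sq s (fun i => Real.sqrt (x i)) (fun i => Real.sqrt (y i))
  have e1 : ∑ i ∈ s, Real.sqrt (x i) ^ 2 = ∑ i ∈ s, x i := sum_congr rfl fun i hi => Real.sq_sqrt (hx i hi)
  have e2 : ∑ i ∈ s, Real.sqrt (y i) ^ 2 = ∑ i ∈ s, y i := sum_congr rfl fun i hi => Real.sq_sqrt (hy i hi)
  rw [e1, e2] at hcs
  have h0 : 0 ≤ ∑ i ∈ s, Real.sqrt (x i) * Real.sqrt (y i) :=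
    sum_nonneg fun i _ => mul_nonneg (Real.sqrt_nonneg _) (Real.sqrt_nonneg _)
  have h1 : ∑ i ∈ s, Real.sqrt (x i) * Real.sqrt (y i) ≤
      Real.sqrt (∑ i ∈ s, x i) * Real.sqrt (∑ i ∈ s, y i) := by
    rw [← Real.sqrt_mul (sum_nonneg hx), ← Real.sqrt_sq h0]
    exact Real.sqrt_le_sqrt hcs
  calc ∑ i ∈ s, P * Real.sqrt (x i) * Real.sqrt (y i) = P * ∑ i ∈ s, Real.sqrt (x i) * Real.sqrt (y i) := by
        rw [mul_sum]; refine sum_congr rfl fun i _ => ?_; ring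
    _ ≤ P * (Real.sqrt (∑ i ∈ s, x i) * Real.sqrt (∑ i ∈ s, y i)) := mul_le_mul_of_nonneg_left h1 hP
    _ = _ := by ring

variable {a h : ℕ}

/-- **Summing the schema's error bound over the moduli `d ≤ D'` with Cauchy–Schwarz.**
[cite: GrimmeltMerikoski2025, §5 ("use Cauchy-Schwarz on d to get ∑_{d ≤ D} |⟨I|Δ_{ad}F₁|α⟩| ≺≺ Z^{1/2} Z₀^θ √(K₁K₂)")] -/
theorem sum_errors_le [DecidableEq ℍ] (ha : 0 < a) (hh : 0 < h) {θ ε' C A : ℝ} (hC : 0 < C) (hε' : 0 < ε')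
    {J : ℕ} (m : ℕ → ℝ)
    (hB : ∀ q : ℕ, 1 ≤ q →
      ∀ (sX sY δ : ℝ) (hsX : 0 < sX), 0 < sY → 0 < δ → δ ≤ 1 → δ < sX / sY →
      ∀ Ψ₁ Ψ₂ : ℝ → ℂ, IsDeltaWeight Ψ₁ 1 2 J δ → IsDeltaWeight Ψ₂ (-1) 1 J δ →
      ∀ (S : Finset ℍ) (b : ℍ → ℝ), (∀ w, 0 ≤ b w) →
      ∀ Z₀ Z₁ Z₂ : ℝ, 1 ≤ Z₀ → 1 ≤ Z₁ → 1 ≤ Z₂ → 2 * sX / sY + 1 ≤ Z₀ * Z₁ * Z₂ →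
        ‖∑ w ∈ S, (b w : ℂ) *
            (orbitSum (Gamma0GL q) (skewTestFun Ψ₁ Ψ₂ sX sY) w -
              (m q : ℂ) * ∫ z : ℍ, skewTestFun Ψ₁ Ψ₂ sX sY z)‖ ≤
          C * (q : ℝ) ^ ε' * δ ^ (-A) * (sX / sY) ^ (1 / 2 : ℝ) * (1 + sX / sY) ^ ε' * Z₀ ^ θ *
            Real.sqrt (automorphicKernel (Gamma0GL q) (kPlus (Z₁ ^ 2)) (iPt sX hsX) (iPt sX hsX)) *
            Real.sqrt (∑ w ∈ S, ∑ w' ∈ S,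
              b w * b w' * automorphicKernel (Gamma0GL q) (kPlus (Z₂ ^ 2)) w' w))
    {Ψ₁ Ψ₂ : ℝ → ℂ} {δ₀ : ℝ} (hΨ₁ : IsDeltaWeight Ψ₁ 1 2 J δ₀) (hΨ₂ : IsDeltaWeight Ψ₂ (-1) 1 J δ₀)
    (hδ₀ : 0 < δ₀) (hδ₁ : δ₀ ≤ 1) {K Xj : ℝ} (hK : 0 < K) (hXj : 0 < Xj)
    (hδr : δ₀ < (Xj / K) / (Real.sqrt ((a * h : ℕ) : ℝ) / (a * K)))
    {Z₀ Z₁ Z₂ : ℝ} (hZ₀ : 1 ≤ Z₀) (hZ₁ : 1 ≤ Z₁) (hZ₂ : 1 ≤ Z₂)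
    (hZ : 2 * (Xj / K) / (Real.sqrt ((a * h : ℕ) : ℝ) / (a * K)) + 1 ≤ Z₀ * Z₁ * Z₂) (D' : ℕ) :
    let sX := Xj / K
    let sY := Real.sqrt ((a * h : ℕ) : ℝ) / (a * K)
    let Φ : ℍ → ℂ := skewTestFun Ψ₁ (fun s => Ψ₂ (-s)) sX sY
    ∑ d ∈ Icc 1 D', ‖∑ w ∈ (heegPairs a h d).image pairPt,
        ((∑ p ∈ (heegPairs a h d).filter (fun p => pairPt p = w), pairWt p : ℝ) : ℂ) *
          (orbitSum (Gamma0GL (a * d)) Φ w - (m (a * d) : ℂ) * ∫ z : ℍ, Φ z)‖ ≤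
      C * ((a * D' : ℕ) : ℝ) ^ ε' * δ₀ ^ (-A) * (sX / sY) ^ (1 / 2 : ℝ) * (1 + sX / sY) ^ ε' * Z₀ ^ θ *
        Real.sqrt (∑ d ∈ Icc 1 D', automorphicKernel (Gamma0GL (a * d)) (kPlus (Z₁ ^ 2))
          (iPt sX (div_pos hXj hK)) (iPt sX (div_pos hXj hK))) *
        Real.sqrt (∑ d ∈ Icc 1 D', ∑ p ∈ heegPairs a h d, ∑ p' ∈ heegPairs a h d,
          pairWt p * pairWt p' * automorphicKernel (Gamma0GL (a * d)) (kPlus (Z₂ ^ 2)) (pairPt p') (pairPt p)) := by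
  intro sX sY Φ
  have hsX : 0 < sX := div_pos hXj hK
  have hah : (0 : ℝ) < ((a * h : ℕ) : ℝ) := by exact_mod_cast Nat.mul_pos ha hh
  have hsY : 0 < sY := by
    show 0 < Real.sqrt ((a * h : ℕ) : ℝ) / (a * K)
    have : (0 : ℝ) < a := by exact_mod_cast ha
    exact div_pos (Real.sqrt_pos.mpr hah) (by positivity)
  set P : ℝ := C * ((a * D' : ℕ) : ℝ) ^ ε' * δ₀ ^ (-A) * (sX / sY) ^ (1 / 2 : ℝ) * (1 + sX / sY) ^ ε' * Z₀ ^ θ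
    with hP
  have hP0 : 0 ≤ P := by
    have : 0 ≤ sX / sY := (div_pos hsX hsY).le
    rw [hP]; positivity
  set x : ℕ → ℝ := fun d => automorphicKernel (Gamma0GL (a * d)) (kPlus (Z₁ ^ 2))
    (iPt sX (div_pos hXj hK)) (iPt sX (div_pos hXj hK)) with hx
  set y : ℕ → ℝ := fun d => ∑ p ∈ heegPairs a h d, ∑ p' ∈ heegPairs a h d,
    pairWt p * pairWt p' * automorphicKernel (Gamma0GL (a * d)) (kPlus (Z₂ ^ 2)) (pairPt p') (pairPt p) with hy
  have hx0 : ∀ d ∈ Icc 1 D', 0 ≤ x d := fun d _ =>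
    automorphicKernel_nonneg _ (fun u => kPlus_nonneg _ _) _ _
  have hy0 : ∀ d ∈ Icc 1 D', 0 ≤ y d := fun d _ =>
    sum_nonneg fun p _ => sum_nonneg fun p' _ => mul_nonneg (mul_nonneg (pairWt_nonneg _) (pairWt_nonneg _))
      (automorphicKernel_nonneg _ (fun u => kPlus_nonneg _ _) _ _)
  -- per modulus
  have hper : ∀ d ∈ Icc 1 D', ‖∑ w ∈ (heegPairs a h d).image pairPt,
      ((∑ p ∈ (heegPairs a h d).filter (fun p => pairPt p = w), pairWt p : ℝ) : ℂ) *
        (orbitSum (Gamma0GL (a * d)) Φ w - (m (a * d) : ℂ) * ∫ z : ℍ, Φ z)‖ ≤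
      P * Real.sqrt (x d) * Real.sqrt (y d) := by
    intro d hd
    rw [mem_Icc] at hd
    have hd0 : 0 < d := hd.1
    haveI : NeZero (a * d) := ⟨(Nat.mul_pos ha hd0).ne'⟩
    have hq1 : 1 ≤ a * d := Nat.mul_pos ha hd0
    have hb := hB (a * d) hq1 sX sY δ₀ hsX hsY hδ₀ hδ₁ hδr Ψ₁ (fun s => Ψ₂ (-s)) hΨ₁ hΨ₂.comp_neg
      ((heegPairs a h d).image pairPt)
      (fun w => ∑ p ∈ (heegPairs a h d).filter (fun p => pairPt p = w), pairWt p)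
      (fun w => fiberWt_nonneg w) Z₀ Z₁ Z₂ hZ₀ hZ₁ hZ₂ hZ
    rw [sum_heegPairs_fiber₂] at hb
    refine hb.trans ?_
    have hqle : ((a * d : ℕ) : ℝ) ^ ε' ≤ ((a * D' : ℕ) : ℝ) ^ ε' := by
      refine Real.rpow_le_rpow (Nat.cast_nonneg _) ?_ hε'.le
      exact_mod_cast Nat.mul_le_mul_left a hd.2
    have hrest : 0 ≤ δ₀ ^ (-A) * (sX / sY) ^ (1 / 2 : ℝ) * (1 + sX / sY) ^ ε' * Z₀ ^ θ *
        Real.sqrt (x d) * Real.sqrt (y d) := by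
      have : 0 ≤ sX / sY := (div_pos hsX hsY).le
      positivity
    calc C * ((a * d : ℕ) : ℝ) ^ ε' * δ₀ ^ (-A) * (sX / sY) ^ (1 / 2 : ℝ) * (1 + sX / sY) ^ ε' * Z₀ ^ θ *
          Real.sqrt (x d) * Real.sqrt (y d)
        = C * ((a * d : ℕ) : ℝ) ^ ε' * (δ₀ ^ (-A) * (sX / sY) ^ (1 / 2 : ℝ) * (1 + sX / sY) ^ ε' * Z₀ ^ θ *
          Real.sqrt (x d) * Real.sqrt (y d)) := by ring
      _ ≤ C * ((a * D' : ℕ) : ℝ) ^ ε' * (δ₀ ^ (-A) * (sX / sY) ^ (1 / 2 : ℝ) * (1 + sX / sY) ^ ε' * Z₀ ^ θ *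
          Real.sqrt (x d) * Real.sqrt (y d)) := by
          refine mul_le_mul_of_nonneg_right (mul_le_mul_of_nonneg_left hqle hC.le) hrest
      _ = P * Real.sqrt (x d) * Real.sqrt (y d) := by rw [hP]; ring
  exact (sum_le_sum hper).trans (sum_mul_sqrt_mul_sqrt_le _ hP0 hx0 hy0)

/-- **`K₁` summed over the moduli** via Proposition 4.2:
`∑_{d ≤ D'} 𝒦_{Γ₀(ad)} k⁺_{Z₁²}(i sX, i sX) ≤ ∑_{q ≤ aD'} kernelDiagSum q sX Z₁² N ≤ C₃ (…)^{ε'} (aD'(1 + sX) + sX⁻¹ + Z₁)`.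
[cite: GrimmeltMerikoski2025, §5 (K₁ ≤ ∑_{q ≤ aD} ⟨I|𝒦_q k_{Z₁²,𝐗}|I⟩ ≺≺ D(1+𝐗) + 𝐗⁻¹ + Z₁)] -/
theorem sum_K1_le (ha : 0 < a) {sX : ℝ} (hsX : 0 < sX) {Z₁ : ℝ} (hZ₁ : 1 ≤ Z₁) {ε' C₃ : ℝ}
    (hC₃ : ∀ (Q N : ℕ) (R Z : ℝ), 0 < R → 1 ≤ Z →
      ∑ q ∈ Icc 1 Q, kernelDiagSum q R Z N ≤ C₃ * ((2 + Z) * (2 + R + R⁻¹)) ^ ε' * (Q * (1 + R) + R⁻¹ + Real.sqrt Z))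
    (D' : ℕ) :
    ∑ d ∈ Icc 1 D', automorphicKernel (Gamma0GL (a * d)) (kPlus (Z₁ ^ 2)) (iPt sX hsX) (iPt sX hsX) ≤
      C₃ * ((2 + Z₁ ^ 2) * (2 + sX + sX⁻¹)) ^ ε' * ((a * D' : ℕ) * (1 + sX) + sX⁻¹ + Z₁) := by
  have hZ0 : 0 ≤ Z₁ ^ 2 := sq_nonneg _
  set N : ℕ := ⌈Real.sqrt (4 * Z₁ ^ 2 + 6) * (1 + sX + sX⁻¹)⌉₊ with hN
  have hNle : Real.sqrt (4 * Z₁ ^ 2 + 6) * (1 + sX + sX⁻¹) ≤ N := Nat.le_ceil _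
  have e : ∀ d ∈ Icc 1 D', automorphicKernel (Gamma0GL (a * d)) (kPlus (Z₁ ^ 2)) (iPt sX hsX) (iPt sX hsX) =
      kernelDiagSum (a * d) sX (Z₁ ^ 2) N := fun d _ => automorphicKernel_iPt_eq_kernelDiagSum hsX hZ0 hNle
  rw [sum_congr rfl e]
  have hinj : Set.InjOn (fun d => a * d) ↑(Icc 1 D') := fun d _ d' _ hdd' => Nat.eq_of_mul_eq_mul_left ha hdd'
  rw [← sum_image (g := fun d => a * d) (f := fun q => kernelDiagSum q sX (Z₁ ^ 2) N) hinj]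
  have hsub : (Icc 1 D').image (fun d => a * d) ⊆ Icc 1 (a * D') := by
    intro q hq
    obtain ⟨d, hd, rfl⟩ := mem_image.mp hq
    rw [mem_Icc] at hd ⊢
    exact ⟨Nat.mul_pos ha hd.1, Nat.mul_le_mul_left a hd.2⟩
  have hnn : ∀ q ∈ Icc 1 (a * D'), q ∉ (Icc 1 D').image (fun d => a * d) → 0 ≤ kernelDiagSum q sX (Z₁ ^ 2) N :=
    fun q _ _ => sum_nonneg fun p _ => kPlus_nonneg _ _
  refine (sum_le_sum_of_subset_of_nonneg hsub hnn).trans ?_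
  have := hC₃ (a * D') N sX (Z₁ ^ 2) hsX (by nlinarith)
  rw [Real.sqrt_sq (by linarith)] at this
  exact_mod_cast this

/-- **`K₂` summed over the moduli** via Proposition 4.1 (`kernelSide_le` + `heegnerKernel_sum_le`).
[cite: GrimmeltMerikoski2025, §5 (K₂ ≤ ∑_{q ≤ aD} ⟨α_q|𝒦_q k_{Z₂²,1}|α_q⟩ ≺≺ D h^{1/2} + h Z₂)] -/
theorem sum_K2_le (ha : 0 < a) (hh : 0 < h) {Z₂ : ℝ} (hZ₂ : 1 ≤ Z₂) {ε' K₄ : ℝ}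
    (hK₄ : ∀ (Q : ℕ), 1 ≤ Q → ∀ (Z : ℝ), 1 ≤ Z → ∀ (N N' : ℕ),
        ∑ q ∈ Icc 1 Q, ∑ t ∈ heegnerReps (a * h), ∑ s ∈ discPairs (a * h) N N',
            kPlus Z (uPair (a * h) ((s.1 : ℤ), s.2) t) * levelWeight (a * h) q s t ≤
          K₄ * (a : ℝ) ^ 4 * (((a * h : ℕ) : ℝ) * Q * Z) ^ ε' *
            ((Q : ℝ) * Real.sqrt ((a * h : ℕ) : ℝ) + ((a * h : ℕ) : ℝ) * Real.sqrt Z))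
    {D' : ℕ} (hD' : 1 ≤ D') :
    ∑ d ∈ Icc 1 D', ∑ p ∈ heegPairs a h d, ∑ p' ∈ heegPairs a h d,
        pairWt p * pairWt p' * automorphicKernel (Gamma0GL (a * d)) (kPlus (Z₂ ^ 2)) (pairPt p') (pairPt p) ≤
      K₄ * (a : ℝ) ^ 4 * (((a * h : ℕ) : ℝ) * ((a * D' : ℕ) : ℝ) * Z₂ ^ 2) ^ ε' *
        (((a * D' : ℕ) : ℝ) * Real.sqrt ((a * h : ℕ) : ℝ) + ((a * h : ℕ) : ℝ) * Z₂) := by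
  have hZ0 : 0 ≤ Z₂ ^ 2 := sq_nonneg _
  set N : ℕ := ⌈8 * (1 + Z₂ ^ 2) * ((a * h : ℕ) : ℝ)⌉₊ with hN
  set N' : ℕ := ⌈24 * (1 + Z₂ ^ 2) * ((a * h : ℕ) : ℝ) ^ 2⌉₊ with hN'
  have hNle : 8 * (1 + Z₂ ^ 2) * ((a * h : ℕ) : ℝ) ≤ N := Nat.le_ceil _
  have hN'le : 24 * (1 + Z₂ ^ 2) * ((a * h : ℕ) : ℝ) ^ 2 ≤ N' := Nat.le_ceil _
  set F : ℕ → ℝ := fun q => ∑ t ∈ heegnerReps (a * h), ∑ s ∈ discPairs (a * h) N N',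
    kPlus (Z₂ ^ 2) (uPair (a * h) ((s.1 : ℤ), s.2) t) * levelWeight (a * h) q s t with hF
  have hF0 : ∀ q, 0 ≤ F q := fun q => sum_nonneg fun t _ => sum_nonneg fun s _ =>
    mul_nonneg (kPlus_nonneg _ _) (levelWeight_nonneg _ _ _ _)
  have hle : ∀ d ∈ Icc 1 D', ∑ p ∈ heegPairs a h d, ∑ p' ∈ heegPairs a h d,
      pairWt p * pairWt p' * automorphicKernel (Gamma0GL (a * d)) (kPlus (Z₂ ^ 2)) (pairPt p') (pairPt p) ≤
      F (a * d) := by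
    intro d hd
    rw [mem_Icc] at hd
    haveI : NeZero (a * d) := ⟨(Nat.mul_pos ha hd.1).ne'⟩
    exact kernelSide_le ha hh hd.1 hZ0 hNle hN'le
  refine (sum_le_sum hle).trans ?_
  have hinj : Set.InjOn (fun d => a * d) ↑(Icc 1 D') := fun d _ d' _ hdd' => Nat.eq_of_mul_eq_mul_left ha hdd'
  rw [← sum_image (g := fun d => a * d) (f := F) hinj]
  have hsub : (Icc 1 D').image (fun d => a * d) ⊆ Icc 1 (a * D') := by
    intro q hq
    obtain ⟨d, hd, rfl⟩ := mem_image.mp hq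
    rw [mem_Icc] at hd ⊢
    exact ⟨Nat.mul_pos ha hd.1, Nat.mul_le_mul_left a hd.2⟩
  refine (sum_le_sum_of_subset_of_nonneg hsub (fun q _ _ => hF0 q)).trans ?_
  have := hK₄ (a * D') (Nat.mul_pos ha hD') (Z₂ ^ 2) (by nlinarith) N N'
  rw [Real.sqrt_sq (by linarith)] at this
  exact this

end sumOverModuli

section bookkeeping

/-! ### Elementary bounds for the parameter choices of §5

Throughout `X ≥ 2`, `θ = 7/64`; `𝔥 = ah`, `s = √(ah)`. -/

/-- `(1 + X/(D(D+√h)))`, the last factor of the bound of Theorem 1.4. [cite: GrimmeltMerikoski2025, Theorem 1.4 (right-hand side)] -/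
def lastFactor (X D hh : ℝ) : ℝ := 1 + X / (D * (D + Real.sqrt hh))

/-- `lastFactor ≥ 1` for `X, D ≥ 0`… (here `X ≥ 0`, `D > 0`). [folklore] -/
theorem one_le_lastFactor {X D hh : ℝ} (hX : 0 ≤ X) (hD : 0 < D) : 1 ≤ lastFactor X D hh := by
  unfold lastFactor
  have : 0 ≤ X / (D * (D + Real.sqrt hh)) := by positivity
  linarith

/-- **The choice of `Z₀`** ([GrimmeltMerikoski2025, §5]: "`Z₀ = 1 + X^{o(1)} X/(D(h^{1/2} + D))`"):
with `r = aX_•/√(ah)`, `Z₁ = D`, `Z₂ = 1 + D/√(ah)`,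
`max(1, (2r+1)/(Z₁Z₂)) ≤ 2a·(1 + X/(D(D + √h)))` when `X_• = X`. [cite: GrimmeltMerikoski2025, §5 (choice of Z₀, Z₁, Z₂)] -/
theorem Z0_le {a h : ℕ} (ha : 0 < a) (hh : 0 < h) {X D : ℝ} (hX : 1 ≤ X) (hD : 1 ≤ D) :
    max 1 ((2 * ((a : ℝ) * X / Real.sqrt ((a * h : ℕ) : ℝ)) + 1) / (D * (1 + D / Real.sqrt ((a * h : ℕ) : ℝ)))) ≤
      2 * a * lastFactor X D h := by
  have ha1 : (1 : ℝ) ≤ a := by exact_mod_cast ha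
  have hh1 : (1 : ℝ) ≤ h := by exact_mod_cast hh
  set s := Real.sqrt ((a * h : ℕ) : ℝ) with hs
  have hah : ((a * h : ℕ) : ℝ) = (a : ℝ) * h := by push_cast; ring
  have hs1 : 1 ≤ s := by rw [hs, hah]; exact Real.one_le_sqrt.mpr (by nlinarith)
  have hs0 : 0 < s := by linarith
  have hsh : Real.sqrt (h : ℝ) ≤ s := by rw [hs, hah]; exact Real.sqrt_le_sqrt (by nlinarith)
  have hsa : s ≤ a * Real.sqrt (h : ℝ) := by
    rw [hs, hah, Real.sqrt_mul (by positivity)]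
    refine mul_le_mul_of_nonneg_right ?_ (Real.sqrt_nonneg _)
    exact Real.sqrt_le_iff.mpr ⟨by linarith, by nlinarith⟩
  have hsqh0 : 0 ≤ Real.sqrt (h : ℝ) := Real.sqrt_nonneg _
  have hL := one_le_lastFactor (hh := (h : ℝ)) (by linarith : (0 : ℝ) ≤ X) (by linarith : (0 : ℝ) < D)
  refine max_le (by nlinarith) ?_
  -- `(2aX/s + 1)/(D(1 + D/s)) = (2aX + s)/(D(s + D))`
  have e : (2 * ((a : ℝ) * X / s) + 1) / (D * (1 + D / s)) = (2 * a * X + s) / (D * (s + D)) := by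
    field_simp
  rw [e, div_le_iff₀ (by positivity)]
  unfold lastFactor
  -- `2aX + s ≤ 2a (1 + X/(D(D+√h))) D (s + D)`:
  have h1 : s ≤ a * (D * (s + D)) := by
    have : D * (s + D) ≥ s := by nlinarith
    nlinarith
  have h2 : 2 * a * X ≤ 2 * a * (X / (D * (D + Real.sqrt (h : ℝ)))) * (D * (s + D)) := by
    have hden : 0 < D * (D + Real.sqrt (h : ℝ)) := by positivity
    have : X ≤ X / (D * (D + Real.sqrt (h : ℝ))) * (D * (s + D)) := by
      rw [div_mul_eq_mul_div, le_div_iff₀ hden]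
      exact mul_le_mul_of_nonneg_left (by nlinarith) (by linarith)
    nlinarith
  nlinarith

end bookkeeping

section bookkeeping2

/-! ### Exponent bookkeeping for §5 (pure real inequalities; `X ≥ 2`, `θ = 7/64`) -/



/-- `2 ≤ X` gives `n ≤ X^k` whenever `n ≤ 2^k`. [folklore] -/
theorem const_le_pow {X : ℝ} (hX : 2 ≤ X) {n : ℝ} {k : ℕ} (hn : n ≤ 2 ^ k) : n ≤ X ^ k :=
  hn.trans (pow_le_pow_left₀ (by norm_num) hX k)

/-- **`K₁` bookkeeping**. [folklore] -/
theorem K1_bookkeeping {X D D' a sX ε₁ C₃ : ℝ} (hX : 2 ≤ X) (hD : 1 ≤ D) (hDX : D ^ 2 ≤ X) (hD'0 : 0 ≤ D')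
    (hD' : D' ≤ D) (ha0 : 0 ≤ a) (ha : a ≤ X ^ ε₁) (hε₁ : 0 < ε₁) (hε₁' : ε₁ ≤ 1 / 4) (hsX : 0 < sX)
    (hsX1 : sX ≤ X ^ (3 * ε₁)) (hsX2 : sX⁻¹ ≤ 2 * D * X ^ ε₁) (hC₃ : 0 ≤ C₃) :
    C₃ * ((2 + D ^ 2) * (2 + sX + sX⁻¹)) ^ ε₁ * (a * D' * (1 + sX) + sX⁻¹ + D) ≤
      5 * C₃ * X ^ (11 * ε₁) * D := by
  have hX1 : (1 : ℝ) ≤ X := by linarith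
  have hX0 : (0 : ℝ) < X := by linarith
  have hXe0 : 0 ≤ X ^ ε₁ := Real.rpow_nonneg hX0.le _
  have hXe : 1 ≤ X ^ ε₁ := Real.one_le_rpow hX1 hε₁.le
  have hX3e : 1 ≤ X ^ (3 * ε₁) := Real.one_le_rpow hX1 (by linarith)
  have hX4e0 : 0 ≤ X ^ (4 * ε₁) := Real.rpow_nonneg hX0.le _
  have hinv0 : 0 < sX⁻¹ := inv_pos.mpr hsX
  have hXe_le : X ^ ε₁ ≤ X := by
    calc X ^ ε₁ ≤ X ^ (1 : ℝ) := Real.rpow_le_rpow_of_exponent_le hX1 (by linarith)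
      _ = X := Real.rpow_one X
  have hX3e_le : X ^ (3 * ε₁) ≤ X := by
    calc X ^ (3 * ε₁) ≤ X ^ (1 : ℝ) := Real.rpow_le_rpow_of_exponent_le hX1 (by linarith)
      _ = X := Real.rpow_one X
  have hDX' : D ≤ X := by nlinarith
  -- the `ε₁`-power factor: base ≤ 12 X³ ≤ X⁷
  have hbase : (2 + D ^ 2) * (2 + sX + sX⁻¹) ≤ X ^ (7 : ℝ) := by
    have h1 : 2 + D ^ 2 ≤ 3 * X := by linarith
    have h2 : sX ≤ X := hsX1.trans hX3e_le
    have h3 : sX⁻¹ ≤ 2 * X * X := hsX2.trans (by nlinarith)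
    have h4 : 2 + sX + sX⁻¹ ≤ 4 * X ^ 2 := by nlinarith
    have h12 : (12 : ℝ) ≤ X ^ 4 := const_le_pow hX (by norm_num)
    calc (2 + D ^ 2) * (2 + sX + sX⁻¹) ≤ (3 * X) * (4 * X ^ 2) :=
          mul_le_mul h1 h4 (by positivity) (by positivity)
      _ = 12 * X ^ 3 := by ring
      _ ≤ X ^ 4 * X ^ 3 := mul_le_mul_of_nonneg_right h12 (by positivity)
      _ = X ^ (7 : ℝ) := by rw [← pow_add, ← Real.rpow_natCast]; norm_num
  have hpow : ((2 + D ^ 2) * (2 + sX + sX⁻¹)) ^ ε₁ ≤ X ^ (7 * ε₁) := by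
    have h0 : 0 ≤ (2 + D ^ 2) * (2 + sX + sX⁻¹) := by positivity
    calc ((2 + D ^ 2) * (2 + sX + sX⁻¹)) ^ ε₁ ≤ (X ^ (7 : ℝ)) ^ ε₁ := Real.rpow_le_rpow h0 hbase hε₁.le
      _ = X ^ (7 * ε₁) := by rw [← Real.rpow_mul hX0.le]
  -- the main factor
  have e4 : X ^ ε₁ * X ^ (3 * ε₁) = X ^ (4 * ε₁) := by
    rw [← Real.rpow_add hX0]; ring_nf
  have h4e : X ^ ε₁ ≤ X ^ (4 * ε₁) := Real.rpow_le_rpow_of_exponent_le hX1 (by linarith)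
  have h14 : 1 ≤ X ^ (4 * ε₁) := Real.one_le_rpow hX1 (by linarith)
  have hmain : a * D' * (1 + sX) + sX⁻¹ + D ≤ 5 * D * X ^ (4 * ε₁) := by
    have h1 : a * D' * (1 + sX) ≤ 2 * D * X ^ (4 * ε₁) := by
      have hs : 1 + sX ≤ 2 * X ^ (3 * ε₁) := by linarith
      calc a * D' * (1 + sX) ≤ (X ^ ε₁ * D) * (2 * X ^ (3 * ε₁)) :=
            mul_le_mul (mul_le_mul ha hD' hD'0 hXe0) hs (by linarith) (by positivity)
        _ = 2 * D * (X ^ ε₁ * X ^ (3 * ε₁)) := by ring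
        _ = 2 * D * X ^ (4 * ε₁) := by rw [e4]
    have h2 : sX⁻¹ ≤ 2 * D * X ^ (4 * ε₁) := hsX2.trans (by nlinarith)
    have h3 : D ≤ D * X ^ (4 * ε₁) := by nlinarith
    linarith
  calc C₃ * ((2 + D ^ 2) * (2 + sX + sX⁻¹)) ^ ε₁ * (a * D' * (1 + sX) + sX⁻¹ + D)
      ≤ C₃ * X ^ (7 * ε₁) * (5 * D * X ^ (4 * ε₁)) :=
        mul_le_mul (mul_le_mul_of_nonneg_left hpow hC₃) hmain (by positivity) (by positivity)
    _ = 5 * C₃ * X ^ (11 * ε₁) * D := by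
        rw [show (11 : ℝ) * ε₁ = 7 * ε₁ + 4 * ε₁ by ring, Real.rpow_add hX0]; ring





set_option maxHeartbeats 400000 in
/-- **`K₂` bookkeeping**: with `s = √(ah)`, `Z₂ = 1 + D/s`:
`K₄ a⁴ ((ah)(aD') Z₂²)^{ε₁} ((aD') s + (ah) Z₂) ≤ 2 K₄ X^{15ε₁} (D√h + h)`. [folklore] -/
theorem K2_bookkeeping {X D D' a h ε₁ K₄ : ℝ} (hX : 2 ≤ X) (hD : 1 ≤ D) (hDX : D ^ 2 ≤ X)
    (hD'1 : 1 ≤ D') (hD' : D' ≤ D) (ha1 : 1 ≤ a) (ha : a ≤ X ^ ε₁) (hh1 : 1 ≤ h) (hh : h ≤ X ^ 3)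
    (hε₁ : 0 < ε₁) (hε₁' : ε₁ ≤ 1 / 4) (hK₄ : 0 ≤ K₄) :
    K₄ * a ^ 4 * ((a * h) * (a * D') * (1 + D / Real.sqrt (a * h)) ^ 2) ^ ε₁ *
        ((a * D') * Real.sqrt (a * h) + (a * h) * (1 + D / Real.sqrt (a * h))) ≤
      2 * K₄ * X ^ (15 * ε₁) * (D * Real.sqrt h + h) := by
  have hX1 : (1 : ℝ) ≤ X := by linarith
  have hX0 : (0 : ℝ) < X := by linarith
  have ha0 : 0 < a := by linarith
  have hh0 : 0 < h := by linarith
  have hs1 : 1 ≤ Real.sqrt (a * h) := Real.one_le_sqrt.mpr (by nlinarith)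
  have hss : Real.sqrt (a * h) ^ 2 = a * h := Real.sq_sqrt (by positivity)
  have hsh1 : 1 ≤ Real.sqrt h := Real.one_le_sqrt.mpr hh1
  have hsa : Real.sqrt (a * h) ≤ a * Real.sqrt h := by
    rw [Real.sqrt_mul ha0.le]
    refine mul_le_mul_of_nonneg_right ?_ (Real.sqrt_nonneg _)
    exact Real.sqrt_le_iff.mpr ⟨by linarith, by nlinarith⟩
  generalize Real.sqrt (a * h) = s at hs1 hss hsa ⊢
  have hs0 : 0 < s := by linarith
  have hXe_le : X ^ ε₁ ≤ X := by
    calc X ^ ε₁ ≤ X ^ (1 : ℝ) := Real.rpow_le_rpow_of_exponent_le hX1 (by linarith)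
      _ = X := Real.rpow_one X
  have haX : a ≤ X := ha.trans hXe_le
  have hDX' : D ≤ X := by nlinarith
  have hZ₂ : 1 + D / s ≤ 2 * D := by
    have : D / s ≤ D := div_le_self (by linarith) hs1
    linarith
  have hZ₂0 : 0 < 1 + D / s := by positivity
  -- the `ε₁`-power factor: base ≤ X⁴ · X² · 4X = 4 X⁷ ≤ X⁹
  have hbase : (a * h) * (a * D') * (1 + D / s) ^ 2 ≤ X ^ (9 : ℝ) := by
    have h1 : a * h ≤ X * X ^ 3 := mul_le_mul haX hh hh0.le hX0.le
    have h2 : a * D' ≤ X * X := mul_le_mul haX (hD'.trans hDX') (by linarith) hX0.le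
    have h3 : (1 + D / s) ^ 2 ≤ 4 * X := by nlinarith
    have h4 : (4 : ℝ) ≤ X ^ 2 := const_le_pow hX (by norm_num)
    calc (a * h) * (a * D') * (1 + D / s) ^ 2 ≤ (X * X ^ 3) * (X * X) * (4 * X) := by
          refine mul_le_mul (mul_le_mul h1 h2 (by positivity) (by positivity)) h3 (by positivity) (by positivity)
      _ = 4 * X ^ 7 := by ring
      _ ≤ X ^ 2 * X ^ 7 := mul_le_mul_of_nonneg_right h4 (by positivity)
      _ = X ^ (9 : ℝ) := by rw [← pow_add, ← Real.rpow_natCast]; norm_num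
  have hpow : ((a * h) * (a * D') * (1 + D / s) ^ 2) ^ ε₁ ≤ X ^ (9 * ε₁) := by
    have h0 : 0 ≤ (a * h) * (a * D') * (1 + D / s) ^ 2 := by positivity
    calc ((a * h) * (a * D') * (1 + D / s) ^ 2) ^ ε₁ ≤ (X ^ (9 : ℝ)) ^ ε₁ := Real.rpow_le_rpow h0 hbase hε₁.le
      _ = X ^ (9 * ε₁) := by rw [← Real.rpow_mul hX0.le]
  -- `a⁴ ≤ X^{4ε₁}`
  have rpow_pow_eq : ∀ (e : ℝ) (n : ℕ), (X ^ e) ^ n = X ^ ((n : ℝ) * e) := fun e n => by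
    rw [← Real.rpow_natCast, ← Real.rpow_mul hX0.le, mul_comm]
  have ha4 : a ^ 4 ≤ X ^ (4 * ε₁) := by
    calc a ^ 4 ≤ (X ^ ε₁) ^ 4 := pow_le_pow_left₀ ha0.le ha 4
      _ = X ^ (4 * ε₁) := by rw [rpow_pow_eq]; norm_num
  -- the main factor: `aD's + ah(1 + D/s) = aD's + ah + sD ≤ 2a²(D√h + h)`
  have hmain : (a * D') * s + (a * h) * (1 + D / s) ≤ 2 * X ^ (2 * ε₁) * (D * Real.sqrt h + h) := by
    have e : (a * h) * (1 + D / s) = a * h + s * D := by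
      have : (a * h) / s = s := by rw [← hss]; field_simp
      calc (a * h) * (1 + D / s) = a * h + (a * h) / s * D := by ring
        _ = a * h + s * D := by rw [this]
    rw [e]
    have h1 : (a * D') * s ≤ a * D * (a * Real.sqrt h) :=
      mul_le_mul (mul_le_mul_of_nonneg_left hD' ha0.le) hsa hs0.le (by positivity)
    have h2 : s * D ≤ (a * Real.sqrt h) * D := mul_le_mul_of_nonneg_right hsa (by linarith)
    have ha2 : a ^ 2 ≤ X ^ (2 * ε₁) := by
      calc a ^ 2 ≤ (X ^ ε₁) ^ 2 := pow_le_pow_left₀ ha0.le ha 2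
        _ = X ^ (2 * ε₁) := by rw [rpow_pow_eq]; norm_num
    have h3 : a * D * (a * Real.sqrt h) + a * h + (a * Real.sqrt h) * D ≤ 2 * a ^ 2 * (D * Real.sqrt h + h) := by
      have hDs : 0 ≤ D * Real.sqrt h := by positivity
      have i1 : a * (D * Real.sqrt h) ≤ a ^ 2 * (D * Real.sqrt h) :=
        mul_le_mul_of_nonneg_right (by nlinarith) hDs
      have i2 : a * h ≤ a ^ 2 * h := mul_le_mul_of_nonneg_right (by nlinarith) hh0.le
      have e1 : a * D * (a * Real.sqrt h) = a ^ 2 * (D * Real.sqrt h) := by ring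
      have e2 : (a * Real.sqrt h) * D = a * (D * Real.sqrt h) := by ring
      rw [e1, e2]; nlinarith
    have h4 : 2 * a ^ 2 * (D * Real.sqrt h + h) ≤ 2 * X ^ (2 * ε₁) * (D * Real.sqrt h + h) := by
      have : 0 ≤ D * Real.sqrt h + h := by positivity
      nlinarith
    linarith
  have hmain0 : 0 ≤ (a * D') * s + (a * h) * (1 + D / s) := by positivity
  have hB0 : 0 ≤ ((a * h) * (a * D') * (1 + D / s) ^ 2) ^ ε₁ := Real.rpow_nonneg (by positivity) _
  generalize ((a * h) * (a * D') * (1 + D / s) ^ 2) ^ ε₁ = Bε at hpow hB0 ⊢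
  generalize (a * D') * s + (a * h) * (1 + D / s) = M at hmain hmain0 ⊢
  have hX4 : 0 ≤ X ^ (4 * ε₁) := Real.rpow_nonneg hX0.le _
  have hX9 : 0 ≤ X ^ (9 * ε₁) := Real.rpow_nonneg hX0.le _
  have hX2 : 0 ≤ X ^ (2 * ε₁) := Real.rpow_nonneg hX0.le _
  have t1 : K₄ * a ^ 4 ≤ K₄ * X ^ (4 * ε₁) := mul_le_mul_of_nonneg_left ha4 hK₄
  have t2 : K₄ * a ^ 4 * Bε ≤ K₄ * X ^ (4 * ε₁) * X ^ (9 * ε₁) :=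
    mul_le_mul t1 hpow hB0 (mul_nonneg hK₄ hX4)
  have t3 : K₄ * a ^ 4 * Bε * M ≤ (K₄ * X ^ (4 * ε₁) * X ^ (9 * ε₁)) * (2 * X ^ (2 * ε₁) * (D * Real.sqrt h + h)) :=
    mul_le_mul t2 hmain hmain0 (mul_nonneg (mul_nonneg hK₄ hX4) hX9)
  have e15 : X ^ (15 * ε₁) = X ^ (4 * ε₁) * X ^ (9 * ε₁) * X ^ (2 * ε₁) := by
    rw [show (15 : ℝ) * ε₁ = 4 * ε₁ + 9 * ε₁ + 2 * ε₁ by ring, Real.rpow_add hX0, Real.rpow_add hX0]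
  calc K₄ * a ^ 4 * Bε * M ≤ (K₄ * X ^ (4 * ε₁) * X ^ (9 * ε₁)) * (2 * X ^ (2 * ε₁) * (D * Real.sqrt h + h)) := t3
    _ = 2 * K₄ * X ^ (15 * ε₁) * (D * Real.sqrt h + h) := by rw [e15]; ring

/-- **The `X`-scale ratio**: `r = aX_•/√(ah) ≤ aX_•/√h`, so
`√r · (√(D√h) + √h) ≤ a √X_• (√D + h^{1/4})`. [folklore] -/
theorem r_bookkeeping {a h Xj D : ℝ} (ha1 : 1 ≤ a) (hh1 : 1 ≤ h) (hXj : 0 ≤ Xj) (hD : 0 ≤ D) :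
    Real.sqrt (a * Xj / Real.sqrt (a * h)) * (Real.sqrt (D * Real.sqrt h) + Real.sqrt h) ≤
      a * Real.sqrt Xj * (Real.sqrt D + h ^ (1 / 4 : ℝ)) := by
  have ha0 : 0 < a := by linarith
  have hh0 : 0 < h := by linarith
  have hsh0 : 0 < Real.sqrt h := Real.sqrt_pos.mpr hh0
  set t := Real.sqrt (Real.sqrt h) with ht
  have ht0 : 0 < t := Real.sqrt_pos.mpr hsh0
  have htt : Real.sqrt h = t ^ 2 := (Real.sq_sqrt hsh0.le).symm
  -- `h^{1/4} = t`
  have e4 : h ^ (1 / 4 : ℝ) = t := by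
    rw [ht, Real.sqrt_eq_rpow, Real.sqrt_eq_rpow, ← Real.rpow_mul hh0.le]; norm_num
  -- `r ≤ a Xj / √h`
  have hr : a * Xj / Real.sqrt (a * h) ≤ a * Xj / Real.sqrt h := by
    refine div_le_div_of_nonneg_left (by positivity) hsh0 ?_
    exact Real.sqrt_le_sqrt (by nlinarith)
  have h1 : Real.sqrt (a * Xj / Real.sqrt (a * h)) ≤ Real.sqrt a * Real.sqrt Xj / t := by
    calc Real.sqrt (a * Xj / Real.sqrt (a * h)) ≤ Real.sqrt (a * Xj / Real.sqrt h) := Real.sqrt_le_sqrt hr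
      _ = Real.sqrt a * Real.sqrt Xj / t := by
          rw [Real.sqrt_div (by positivity), Real.sqrt_mul ha0.le, ht]
  have hsa : Real.sqrt a ≤ a := Real.sqrt_le_iff.mpr ⟨by linarith, by nlinarith⟩
  have hfac : Real.sqrt (D * Real.sqrt h) + Real.sqrt h = t * (Real.sqrt D + t) := by
    rw [htt, Real.sqrt_mul hD, Real.sqrt_sq ht0.le]; ring
  rw [hfac, e4]
  calc Real.sqrt (a * Xj / Real.sqrt (a * h)) * (t * (Real.sqrt D + t))
      ≤ (Real.sqrt a * Real.sqrt Xj / t) * (t * (Real.sqrt D + t)) :=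
        mul_le_mul_of_nonneg_right h1 (by positivity)
    _ = Real.sqrt a * Real.sqrt Xj * (Real.sqrt D + t) := by field_simp
    _ ≤ a * Real.sqrt Xj * (Real.sqrt D + t) := by
        refine mul_le_mul_of_nonneg_right (mul_le_mul_of_nonneg_right hsa (Real.sqrt_nonneg _)) (by positivity)





/-- **The product bookkeeping** for one `j` (ratio `ρ = X_j/X ≥ 1`, factor `X/X_j = ρ⁻¹`). [folklore] -/
theorem product_bookkeeping {X Xj a h D L ε₁ C Q E E₀ C₃ K₄ K1 K2 Zj : ℝ} (hX : 2 ≤ X)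
    (hXj : X ≤ Xj) (hXj4 : Xj ≤ X ^ 4) (ha1 : 1 ≤ a) (ha : a ≤ X ^ ε₁) (hh1 : 1 ≤ h) (hD : 1 ≤ D)
    (hL : 1 ≤ L) (hε₁ : 0 < ε₁) (hε₁' : ε₁ ≤ 1 / 4) (hC : 0 ≤ C) (hQ0 : 0 ≤ Q) (hQ : Q ≤ X ^ ε₁)
    (hE0 : 0 ≤ E) (hE₀ : 1 ≤ E₀) (hE : E ≤ E₀ * X ^ ε₁) (hC₃ : 0 ≤ C₃) (hK₄ : 0 ≤ K₄)
    (hK1 : K1 ≤ 5 * C₃ * X ^ (11 * ε₁) * D)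
    (hK2 : K2 ≤ 2 * K₄ * X ^ (15 * ε₁) * (D * Real.sqrt h + h))
    (hZj0 : 0 ≤ Zj) (hZj : Zj ≤ (Xj / X) * (2 * a * L)) :
    (X / Xj) * (C * Q * E * Real.sqrt (a * Xj / Real.sqrt (a * h)) * (1 + a * Xj / Real.sqrt (a * h)) ^ ε₁ *
        Zj ^ (7 / 64 : ℝ) * Real.sqrt K1 * Real.sqrt K2) ≤
      (2 * C * E₀ * Real.sqrt (5 * C₃) * Real.sqrt (2 * K₄)) * X ^ (23 * ε₁) *
        (Real.sqrt D * Real.sqrt X * (Real.sqrt D + h ^ (1 / 4 : ℝ)) * L ^ (7 / 64 : ℝ)) := by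
  have hX1 : (1 : ℝ) ≤ X := by linarith
  have hX0 : (0 : ℝ) < X := by linarith
  have hXj0 : 0 < Xj := by linarith
  have ha0 : 0 < a := by linarith
  have hh0 : 0 < h := by linarith
  have hθ0 : (0 : ℝ) ≤ 7 / 64 := by norm_num
  set ρ := Xj / X with hρ
  have hρ1 : 1 ≤ ρ := by rw [hρ, le_div_iff₀ hX0]; linarith
  have hρ0 : 0 < ρ := by linarith
  have hXe_le : X ^ ε₁ ≤ X := by
    calc X ^ ε₁ ≤ X ^ (1 : ℝ) := Real.rpow_le_rpow_of_exponent_le hX1 (by linarith)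
      _ = X := Real.rpow_one X
  have haX : a ≤ X := ha.trans hXe_le
  set s := Real.sqrt (a * h) with hs
  have hs1 : 1 ≤ s := by rw [hs]; exact Real.one_le_sqrt.mpr (by nlinarith)
  have hs0 : 0 < s := by linarith
  set r₁ := a * X / s with hr₁
  set rj := a * Xj / s with hrj
  have hr₁0 : 0 < r₁ := by positivity
  have hrj_eq : rj = ρ * r₁ := by rw [hrj, hρ, hr₁]; field_simp
  -- (1) `(1 + rj)^{ε₁} ≤ X^{6ε₁}`
  have h1 : (1 + rj) ^ ε₁ ≤ X ^ (6 * ε₁) := by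
    have hrj_le : rj ≤ X ^ 5 := by
      rw [hrj, div_le_iff₀ hs0]
      calc a * Xj ≤ X * X ^ 4 := mul_le_mul haX hXj4 hXj0.le hX0.le
        _ = X ^ 5 := by ring
        _ ≤ X ^ 5 * s := le_mul_of_one_le_right (by positivity) hs1
    have h2X : (2 : ℝ) ≤ X ^ 1 := by rw [pow_one]; exact hX
    have hb : 1 + rj ≤ X ^ (6 : ℝ) := by
      calc 1 + rj ≤ 2 * X ^ 5 := by
            have : (1 : ℝ) ≤ X ^ 5 := one_le_pow₀ hX1
            linarith
        _ ≤ X ^ 1 * X ^ 5 := mul_le_mul_of_nonneg_right h2X (by positivity)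
        _ = X ^ (6 : ℝ) := by rw [← pow_add, ← Real.rpow_natCast]; norm_num
    calc (1 + rj) ^ ε₁ ≤ (X ^ (6 : ℝ)) ^ ε₁ := Real.rpow_le_rpow (by positivity) hb hε₁.le
      _ = X ^ (6 * ε₁) := by rw [← Real.rpow_mul hX0.le]
  -- (2) `(X/Xj) √rj Zj^θ ≤ 2a √r₁ L^θ`
  have h2 : (X / Xj) * Real.sqrt rj * Zj ^ (7 / 64 : ℝ) ≤ 2 * a * Real.sqrt r₁ * L ^ (7 / 64 : ℝ) := by
    have eX : X / Xj = ρ⁻¹ := by rw [hρ, inv_div]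
    have hZθ : Zj ^ (7 / 64 : ℝ) ≤ ρ ^ (7 / 64 : ℝ) * (2 * a) * L ^ (7 / 64 : ℝ) := by
      calc Zj ^ (7 / 64 : ℝ) ≤ (ρ * (2 * a * L)) ^ (7 / 64 : ℝ) := Real.rpow_le_rpow hZj0 hZj hθ0
        _ = ρ ^ (7 / 64 : ℝ) * ((2 * a) ^ (7 / 64 : ℝ) * L ^ (7 / 64 : ℝ)) := by
            rw [Real.mul_rpow hρ0.le (by positivity), Real.mul_rpow (by positivity) (by linarith)]
        _ ≤ ρ ^ (7 / 64 : ℝ) * ((2 * a) * L ^ (7 / 64 : ℝ)) := by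
            refine mul_le_mul_of_nonneg_left (mul_le_mul_of_nonneg_right ?_ (by positivity)) (by positivity)
            calc (2 * a) ^ (7 / 64 : ℝ) ≤ (2 * a) ^ (1 : ℝ) := Real.rpow_le_rpow_of_exponent_le (by linarith) (by norm_num)
              _ = 2 * a := Real.rpow_one _
        _ = _ := by ring
    have hsq : Real.sqrt rj = Real.sqrt ρ * Real.sqrt r₁ := by rw [hrj_eq, Real.sqrt_mul hρ0.le]
    -- `ρ⁻¹ √ρ ρ^θ = ρ^{θ - 1/2} ≤ 1`
    have hρpow : ρ⁻¹ * Real.sqrt ρ * ρ ^ (7 / 64 : ℝ) ≤ 1 := by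
      rw [Real.sqrt_eq_rpow, ← Real.rpow_neg_one, ← Real.rpow_add hρ0, ← Real.rpow_add hρ0]
      exact Real.rpow_le_one_of_one_le_of_nonpos hρ1 (by norm_num)
    calc (X / Xj) * Real.sqrt rj * Zj ^ (7 / 64 : ℝ)
        ≤ (X / Xj) * Real.sqrt rj * (ρ ^ (7 / 64 : ℝ) * (2 * a) * L ^ (7 / 64 : ℝ)) :=
          mul_le_mul_of_nonneg_left hZθ (by positivity)
      _ = (ρ⁻¹ * Real.sqrt ρ * ρ ^ (7 / 64 : ℝ)) * (2 * a * Real.sqrt r₁ * L ^ (7 / 64 : ℝ)) := by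
          rw [eX, hsq]; ring
      _ ≤ 1 * (2 * a * Real.sqrt r₁ * L ^ (7 / 64 : ℝ)) :=
          mul_le_mul_of_nonneg_right hρpow (by positivity)
      _ = _ := one_mul _
  -- (3) square roots of the kernel bounds
  have h3 : Real.sqrt K1 ≤ Real.sqrt (5 * C₃) * X ^ (11 * ε₁ / 2) * Real.sqrt D := by
    calc Real.sqrt K1 ≤ Real.sqrt (5 * C₃ * X ^ (11 * ε₁) * D) := Real.sqrt_le_sqrt hK1
      _ = Real.sqrt (5 * C₃) * Real.sqrt (X ^ (11 * ε₁)) * Real.sqrt D := by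
          rw [Real.sqrt_mul (by positivity), Real.sqrt_mul (by positivity)]
      _ = _ := by
          rw [Real.sqrt_eq_rpow (X ^ (11 * ε₁)), ← Real.rpow_mul hX0.le]; ring_nf
  have h4 : Real.sqrt K2 ≤ Real.sqrt (2 * K₄) * X ^ (15 * ε₁ / 2) * (Real.sqrt (D * Real.sqrt h) + Real.sqrt h) := by
    calc Real.sqrt K2 ≤ Real.sqrt (2 * K₄ * X ^ (15 * ε₁) * (D * Real.sqrt h + h)) := Real.sqrt_le_sqrt hK2
      _ = Real.sqrt (2 * K₄) * Real.sqrt (X ^ (15 * ε₁)) * Real.sqrt (D * Real.sqrt h + h) := by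
          rw [Real.sqrt_mul (by positivity), Real.sqrt_mul (by positivity)]
      _ ≤ Real.sqrt (2 * K₄) * Real.sqrt (X ^ (15 * ε₁)) * (Real.sqrt (D * Real.sqrt h) + Real.sqrt h) := by
          refine mul_le_mul_of_nonneg_left ?_ (by positivity)
          -- `√(x + y) ≤ √x + √y`
          rw [Real.sqrt_le_left (by positivity)]
          have hx := Real.sq_sqrt (show 0 ≤ D * Real.sqrt h by positivity)
          have hy := Real.sq_sqrt hh0.le
          nlinarith [Real.sqrt_nonneg (D * Real.sqrt h), Real.sqrt_nonneg h]
      _ = _ := by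
          rw [Real.sqrt_eq_rpow (X ^ (15 * ε₁)), ← Real.rpow_mul hX0.le]; ring_nf
  -- (4) the `r`-bookkeeping: `√r₁ (√(D√h) + √h) ≤ a √X (√D + h^{1/4})`
  have h5 : Real.sqrt r₁ * (Real.sqrt (D * Real.sqrt h) + Real.sqrt h) ≤
      a * Real.sqrt X * (Real.sqrt D + h ^ (1 / 4 : ℝ)) :=
    r_bookkeeping ha1 hh1 hX0.le (by linarith)
  -- (5) `a² ≤ X^{2ε₁}`
  have ha2 : a * a ≤ X ^ (2 * ε₁) := by
    calc a * a ≤ X ^ ε₁ * X ^ ε₁ := mul_le_mul ha ha ha0.le (by positivity)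
      _ = X ^ (2 * ε₁) := by rw [← Real.rpow_add hX0]; ring_nf
  -- assemble
  have hCQE : C * Q * E ≤ C * E₀ * X ^ (2 * ε₁) := by
    calc C * Q * E ≤ C * X ^ ε₁ * (E₀ * X ^ ε₁) :=
          mul_le_mul (mul_le_mul_of_nonneg_left hQ hC) hE hE0 (by positivity)
      _ = C * E₀ * (X ^ ε₁ * X ^ ε₁) := by ring
      _ = C * E₀ * X ^ (2 * ε₁) := by rw [← Real.rpow_add hX0]; ring_nf
  -- regroup the left-hand side
  have eL : (X / Xj) * (C * Q * E * Real.sqrt rj * (1 + rj) ^ ε₁ * Zj ^ (7 / 64 : ℝ) * Real.sqrt K1 * Real.sqrt K2) =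
      (C * Q * E) * (1 + rj) ^ ε₁ * ((X / Xj) * Real.sqrt rj * Zj ^ (7 / 64 : ℝ)) * Real.sqrt K1 * Real.sqrt K2 := by
    ring
  rw [eL]
  have hstep : (C * Q * E) * (1 + rj) ^ ε₁ * ((X / Xj) * Real.sqrt rj * Zj ^ (7 / 64 : ℝ)) * Real.sqrt K1 * Real.sqrt K2 ≤
      (C * E₀ * X ^ (2 * ε₁)) * X ^ (6 * ε₁) * (2 * a * Real.sqrt r₁ * L ^ (7 / 64 : ℝ)) *
        (Real.sqrt (5 * C₃) * X ^ (11 * ε₁ / 2) * Real.sqrt D) *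
        (Real.sqrt (2 * K₄) * X ^ (15 * ε₁ / 2) * (Real.sqrt (D * Real.sqrt h) + Real.sqrt h)) := by
    have n1 : 0 ≤ (C * Q * E) := by positivity
    have n2 : 0 ≤ (1 + rj) ^ ε₁ := Real.rpow_nonneg (by positivity) _
    have n3 : 0 ≤ (X / Xj) * Real.sqrt rj * Zj ^ (7 / 64 : ℝ) := by positivity
    refine mul_le_mul (mul_le_mul (mul_le_mul (mul_le_mul hCQE h1 n2 (by positivity)) h2 n3 (by positivity))
      h3 (Real.sqrt_nonneg _) (by positivity)) h4 (Real.sqrt_nonneg _) (by positivity)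
  refine hstep.trans ?_
  -- collect: powers of `X` and the structural part
  have eX : X ^ (2 * ε₁) * X ^ (6 * ε₁) * X ^ (11 * ε₁ / 2) * X ^ (15 * ε₁ / 2) = X ^ (21 * ε₁) := by
    rw [← Real.rpow_add hX0, ← Real.rpow_add hX0, ← Real.rpow_add hX0]; ring_nf
  have e2 : (C * E₀ * X ^ (2 * ε₁)) * X ^ (6 * ε₁) * (2 * a * Real.sqrt r₁ * L ^ (7 / 64 : ℝ)) *
        (Real.sqrt (5 * C₃) * X ^ (11 * ε₁ / 2) * Real.sqrt D) *
        (Real.sqrt (2 * K₄) * X ^ (15 * ε₁ / 2) * (Real.sqrt (D * Real.sqrt h) + Real.sqrt h)) =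
      (2 * C * E₀ * Real.sqrt (5 * C₃) * Real.sqrt (2 * K₄)) *
        (X ^ (2 * ε₁) * X ^ (6 * ε₁) * X ^ (11 * ε₁ / 2) * X ^ (15 * ε₁ / 2)) *
        (a * (Real.sqrt r₁ * (Real.sqrt (D * Real.sqrt h) + Real.sqrt h)) * Real.sqrt D * L ^ (7 / 64 : ℝ)) := by
    ring
  rw [e2, eX]
  have hM0 : 0 ≤ 2 * C * E₀ * Real.sqrt (5 * C₃) * Real.sqrt (2 * K₄) := by positivity
  -- `a · (√r₁ (…)) · √D · L^θ ≤ a · a√X(√D + h^{1/4}) · √D · L^θ ≤ X^{2ε₁} √X (√D + h^{1/4}) √D L^θ`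
  have hstruct : a * (Real.sqrt r₁ * (Real.sqrt (D * Real.sqrt h) + Real.sqrt h)) * Real.sqrt D * L ^ (7 / 64 : ℝ) ≤
      X ^ (2 * ε₁) * (Real.sqrt D * Real.sqrt X * (Real.sqrt D + h ^ (1 / 4 : ℝ)) * L ^ (7 / 64 : ℝ)) := by
    calc a * (Real.sqrt r₁ * (Real.sqrt (D * Real.sqrt h) + Real.sqrt h)) * Real.sqrt D * L ^ (7 / 64 : ℝ)
        ≤ a * (a * Real.sqrt X * (Real.sqrt D + h ^ (1 / 4 : ℝ))) * Real.sqrt D * L ^ (7 / 64 : ℝ) := by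
          refine mul_le_mul_of_nonneg_right (mul_le_mul_of_nonneg_right
            (mul_le_mul_of_nonneg_left h5 ha0.le) (Real.sqrt_nonneg _)) (by positivity)
      _ = (a * a) * (Real.sqrt D * Real.sqrt X * (Real.sqrt D + h ^ (1 / 4 : ℝ)) * L ^ (7 / 64 : ℝ)) := by ring
      _ ≤ _ := mul_le_mul_of_nonneg_right ha2 (by positivity)
  calc (2 * C * E₀ * Real.sqrt (5 * C₃) * Real.sqrt (2 * K₄)) * X ^ (21 * ε₁) *
        (a * (Real.sqrt r₁ * (Real.sqrt (D * Real.sqrt h) + Real.sqrt h)) * Real.sqrt D * L ^ (7 / 64 : ℝ))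
      ≤ (2 * C * E₀ * Real.sqrt (5 * C₃) * Real.sqrt (2 * K₄)) * X ^ (21 * ε₁) *
        (X ^ (2 * ε₁) * (Real.sqrt D * Real.sqrt X * (Real.sqrt D + h ^ (1 / 4 : ℝ)) * L ^ (7 / 64 : ℝ))) :=
        mul_le_mul_of_nonneg_left hstruct (by positivity)
    _ = _ := by
        rw [show (23 : ℝ) * ε₁ = 21 * ε₁ + 2 * ε₁ by ring, Real.rpow_add hX0]; ring





/-- **Facts about `X₂ = K^{1/(1-η)}`** ([GrimmeltMerikoski2025, §5]: "Let X₁ = X and X₂ = K^{1/(1−η)} > X₁"):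
for `0 < η ≤ 1/3`, `1 ≤ X`, `X^{1−η} ≤ K ≤ X²`:
`X ≤ X₂`, `X₂ ≤ X⁴`, `1 ≤ X₂/K ≤ X^{3η}`, and `2K/X₂ ≤ 2 X^{−η}`. [folklore] -/
theorem X2_facts {X K η : ℝ} (hX : 1 ≤ X) (hη : 0 < η) (hη3 : η ≤ 1 / 3) (hKlo : X ^ (1 - η) ≤ K)
    (hKhi : K ≤ X ^ 2) :
    let X₂ := K ^ (1 / (1 - η))
    X ≤ X₂ ∧ X₂ ≤ X ^ 4 ∧ 1 ≤ X₂ / K ∧ X₂ / K ≤ X ^ (3 * η) ∧ 2 * K / X₂ ≤ 2 * X ^ (-η) := by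
  intro X₂
  have hX0 : 0 < X := by linarith
  have h1η : 0 < 1 - η := by linarith
  have hK1 : 1 ≤ K := le_trans (Real.one_le_rpow hX h1η.le) hKlo
  have hK0 : 0 < K := by linarith
  have e_inv : (1 - η) * (1 / (1 - η)) = 1 := by field_simp
  -- `X ≤ X₂`
  have hXX₂ : X ≤ X₂ := by
    calc X = (X ^ (1 - η)) ^ (1 / (1 - η)) := by rw [← Real.rpow_mul hX0.le, e_inv, Real.rpow_one]
      _ ≤ K ^ (1 / (1 - η)) := Real.rpow_le_rpow (by positivity) hKlo (by positivity)
  -- `X₂ ≤ X⁴`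
  have hexp4 : 2 * (1 / (1 - η)) ≤ 4 := by
    rw [mul_one_div, div_le_iff₀ h1η]; linarith
  have hX₂4 : X₂ ≤ X ^ 4 := by
    calc X₂ ≤ (X ^ 2) ^ (1 / (1 - η)) := Real.rpow_le_rpow hK0.le hKhi (by positivity)
      _ = X ^ (2 * (1 / (1 - η))) := by
          rw [show (X ^ 2 : ℝ) = X ^ (2 : ℝ) by rw [Real.rpow_two], ← Real.rpow_mul hX0.le]
      _ ≤ X ^ (4 : ℝ) := Real.rpow_le_rpow_of_exponent_le hX hexp4
      _ = X ^ 4 := by rw [show (4 : ℝ) = ((4 : ℕ) : ℝ) by norm_num, Real.rpow_natCast]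
  -- `X₂ / K = K^{η/(1-η)}`
  have eq : X₂ / K = K ^ (η / (1 - η)) := by
    have : η / (1 - η) = 1 / (1 - η) - 1 := by field_simp; ring
    rw [this, Real.rpow_sub_one hK0.ne']
  have hexp0 : 0 ≤ η / (1 - η) := by positivity
  have h3 : 1 ≤ X₂ / K := by rw [eq]; exact Real.one_le_rpow hK1 hexp0
  have hexp3 : 2 * (η / (1 - η)) ≤ 3 * η := by
    rw [mul_div_assoc', div_le_iff₀ h1η]; nlinarith
  have h4 : X₂ / K ≤ X ^ (3 * η) := by
    rw [eq]
    calc K ^ (η / (1 - η)) ≤ (X ^ 2) ^ (η / (1 - η)) := Real.rpow_le_rpow hK0.le hKhi hexp0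
      _ = X ^ (2 * (η / (1 - η))) := by
          rw [show (X ^ 2 : ℝ) = X ^ (2 : ℝ) by rw [Real.rpow_two], ← Real.rpow_mul hX0.le]
      _ ≤ X ^ (3 * η) := Real.rpow_le_rpow_of_exponent_le hX hexp3
  -- `2K/X₂ = 2 K^{-η/(1-η)} ≤ 2 X^{-η}`
  have h5 : 2 * K / X₂ ≤ 2 * X ^ (-η) := by
    have e1 : 2 * K / X₂ = 2 * (X₂ / K)⁻¹ := by
      rw [inv_div]; ring
    rw [e1, eq, ← Real.rpow_neg hK0.le]
    refine mul_le_mul_of_nonneg_left ?_ (by norm_num)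
    -- `K^{-η/(1-η)} ≤ (X^{1-η})^{-η/(1-η)} = X^{-η}`
    have hneg : -(η / (1 - η)) ≤ 0 := by linarith
    calc K ^ (-(η / (1 - η))) ≤ (X ^ (1 - η)) ^ (-(η / (1 - η))) :=
          Real.rpow_le_rpow_of_nonpos (by positivity) hKlo hneg
      _ = X ^ (-η) := by
          rw [← Real.rpow_mul hX0.le]
          congr 1
          field_simp
  exact ⟨hXX₂, hX₂4, h3, h4, h5⟩

/-- **The Poisson remainder of the second scale is negligible**: with `B = X^δ ≤ X`, `D ≤ X^{1/2}`,
`K ≤ X²`, `X/X₂ ≤ 1`, `2K/X₂ ≤ 2X^{-ε₁}` and `ε₁ (J - 1) ≥ 8`, `X ≥ 2^{J+2}`: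
`⌊D⌋₊ · 2K · B · ((X/X₂) · (2B · 2K · (2K/X₂)^{J-1})) ≤ 1`. [folklore] -/
theorem poissonErr_le_one {X D K B c t ε₁ : ℝ} {J Dn : ℕ} (hX : 2 ≤ X) (hDn : (Dn : ℝ) ≤ D) (hD : D ≤ X)
    (hK0 : 0 ≤ K) (hK : K ≤ X ^ 2) (hB0 : 0 ≤ B) (hB : B ≤ X) (hc0 : 0 ≤ c) (hc : c ≤ 1) (ht0 : 0 ≤ t)
    (ht : t ≤ 2 * X ^ (-ε₁)) (hJ : 8 ≤ ε₁ * ((J - 1 : ℕ) : ℝ)) (hXJ : (2 : ℝ) ^ (J + 2) ≤ X) :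
    (Dn : ℝ) * (2 * K) * (B * (c * (2 * B * (2 * K) * t ^ (J - 1)))) ≤ 1 := by
  have hX0 : 0 < X := by linarith
  have hX1 : 1 ≤ X := by linarith
  -- `t^{J-1} ≤ 2^{J-1} X^{-8}`
  have ht' : t ^ (J - 1) ≤ (2 : ℝ) ^ (J - 1) * X ^ (-(8 : ℝ)) := by
    calc t ^ (J - 1) ≤ (2 * X ^ (-ε₁)) ^ (J - 1) := pow_le_pow_left₀ ht0 ht _
      _ = (2 : ℝ) ^ (J - 1) * (X ^ (-ε₁)) ^ (J - 1) := mul_pow _ _ _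
      _ = (2 : ℝ) ^ (J - 1) * X ^ (-(ε₁ * ((J - 1 : ℕ) : ℝ))) := by
          rw [← Real.rpow_natCast (X ^ (-ε₁)), ← Real.rpow_mul hX0.le]; ring_nf
      _ ≤ (2 : ℝ) ^ (J - 1) * X ^ (-(8 : ℝ)) := by
          refine mul_le_mul_of_nonneg_left (Real.rpow_le_rpow_of_exponent_le hX1 (by linarith)) (by positivity)
  -- prefactor `≤ 8 X⁷`
  have hDn0 : (0 : ℝ) ≤ Dn := Nat.cast_nonneg _
  have hpre : (Dn : ℝ) * (2 * K) * (B * (c * (2 * B * (2 * K)))) ≤ 8 * X ^ 7 := by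
    have h1 : (Dn : ℝ) ≤ X := hDn.trans hD
    have h2 : (Dn : ℝ) * K ≤ X * X ^ 2 := mul_le_mul h1 hK hK0 hX0.le
    have h3 : B * B ≤ X * X := mul_le_mul hB hB hB0 hX0.le
    have h4 : c * K ≤ 1 * X ^ 2 := mul_le_mul hc hK hK0 zero_le_one
    calc (Dn : ℝ) * (2 * K) * (B * (c * (2 * B * (2 * K)))) = 8 * ((Dn : ℝ) * K) * (B * B) * (c * K) := by ring
      _ ≤ 8 * (X * X ^ 2) * (X * X) * (1 * X ^ 2) := by
          refine mul_le_mul (mul_le_mul (mul_le_mul_of_nonneg_left h2 (by norm_num)) h3 (by positivity)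
            (by positivity)) h4 (by positivity) (by positivity)
      _ = 8 * X ^ 7 := by ring
  have e : (Dn : ℝ) * (2 * K) * (B * (c * (2 * B * (2 * K) * t ^ (J - 1)))) =
      ((Dn : ℝ) * (2 * K) * (B * (c * (2 * B * (2 * K))))) * t ^ (J - 1) := by ring
  rw [e]
  have hJpos : 0 < J := by
    rcases Nat.eq_zero_or_pos J with hJ0 | hJ0
    · subst hJ0; simp at hJ; linarith
    · exact hJ0
  calc ((Dn : ℝ) * (2 * K) * (B * (c * (2 * B * (2 * K))))) * t ^ (J - 1)
      ≤ (8 * X ^ 7) * ((2 : ℝ) ^ (J - 1) * X ^ (-(8 : ℝ))) := mul_le_mul hpre ht' (by positivity) (by positivity)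
    _ = 8 * 2 ^ (J - 1) * (X ^ 7 * X ^ (-(8 : ℝ))) := by ring
    _ = 8 * 2 ^ (J - 1) * X ^ (-(1 : ℝ)) := by
        rw [show (X ^ 7 : ℝ) = X ^ ((7 : ℕ) : ℝ) from (Real.rpow_natCast X 7).symm, ← Real.rpow_add hX0]
        norm_num
    _ ≤ 1 := by
        rw [Real.rpow_neg hX0.le, Real.rpow_one, ← div_eq_mul_inv, div_le_one hX0]
        -- `8 · 2^{J-1} = 2^{J+2} ≤ X`
        have h1 : (8 : ℝ) * 2 ^ (J - 1) = 2 ^ (J + 2) := by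
          have : J + 2 = (J - 1) + 3 := by omega
          rw [this, pow_add]; norm_num; ring
        linarith


end bookkeeping2

section finalAssembly

open RootForms
open Literature.NumberTheory.Automorphic (automorphicKernel)

/-- The bound of Theorem 1.4 with square roots equals the target expression. [folklore] -/
theorem bound_eq (X D : ℝ) (h : ℕ) :
    Real.sqrt D * Real.sqrt X * (Real.sqrt D + (h : ℝ) ^ (1 / 4 : ℝ)) * lastFactor X D h ^ (7 / 64 : ℝ) =
      D ^ (1 / 2 : ℝ) * X ^ (1 / 2 : ℝ) * (D ^ (1 / 2 : ℝ) + (h : ℝ) ^ (1 / 4 : ℝ)) *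
        (1 + X / (D * (D + (h : ℝ) ^ (1 / 2 : ℝ)))) ^ (7 / 64 : ℝ) := by
  rw [Real.sqrt_eq_rpow, Real.sqrt_eq_rpow, lastFactor, Real.sqrt_eq_rpow]

/-- The target bound is at least `1` (for `X, D ≥ 1`). [folklore] -/
theorem one_le_bound {X D : ℝ} (h : ℕ) (hX : 1 ≤ X) (hD : 1 ≤ D) :
    1 ≤ Real.sqrt D * Real.sqrt X * (Real.sqrt D + (h : ℝ) ^ (1 / 4 : ℝ)) * lastFactor X D h ^ (7 / 64 : ℝ) := by
  have hL1 : 1 ≤ lastFactor X D h := one_le_lastFactor (by linarith) (by linarith)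
  have h1 : 1 ≤ Real.sqrt D := Real.one_le_sqrt.mpr hD
  have h2 : 1 ≤ Real.sqrt X := Real.one_le_sqrt.mpr hX
  have h3 : 1 ≤ Real.sqrt D + (h : ℝ) ^ (1 / 4 : ℝ) := by
    have : 0 ≤ (h : ℝ) ^ (1 / 4 : ℝ) := Real.rpow_nonneg (by positivity) _
    linarith
  have h4 : 1 ≤ lastFactor X D h ^ (7 / 64 : ℝ) := Real.one_le_rpow hL1 (by norm_num)
  calc (1 : ℝ) = 1 * 1 * 1 * 1 := by ring
    _ ≤ _ := mul_le_mul (mul_le_mul (mul_le_mul h1 h2 zero_le_one (by linarith)) h3 zero_le_one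
        (by positivity)) h4 zero_le_one (by positivity)

/-- **`δ₀ = X^{-δ}/2 < 𝐗_j/𝐘 = aX_j/√(ah)`** (`≥ X/√h ≥ X^{-δ/2}`). [cite: GrimmeltMerikoski2025, §5 ("δ^{-1} ≺≺ 1")] -/
theorem delta0_lt_ratio {a h : ℕ} (ha : 0 < a) (hh : 0 < h) {X δ Xj K : ℝ} (hX : 1 ≤ X) (hδ : 0 < δ)
    (hhX : (h : ℝ) ≤ X ^ (2 + δ)) (hXj : X ≤ Xj) (hK : 0 < K) :
    X ^ (-δ) / 2 < (Xj / K) / (Real.sqrt ((a * h : ℕ) : ℝ) / (a * K)) := by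
  have hX0 : 0 < X := by linarith
  have ha1 : (1 : ℝ) ≤ a := by exact_mod_cast ha
  have hh1 : (1 : ℝ) ≤ h := by exact_mod_cast hh
  have hahr : ((a * h : ℕ) : ℝ) = (a : ℝ) * h := by push_cast; ring
  have hs0 : 0 < Real.sqrt ((a * h : ℕ) : ℝ) := Real.sqrt_pos.mpr (by rw [hahr]; positivity)
  have e : (Xj / K) / (Real.sqrt ((a * h : ℕ) : ℝ) / (a * K)) = a * Xj / Real.sqrt ((a * h : ℕ) : ℝ) := by
    field_simp
  rw [e]
  have hsah : Real.sqrt ((a * h : ℕ) : ℝ) ≤ a * Real.sqrt h := by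
    rw [hahr, Real.sqrt_mul (by positivity)]
    refine mul_le_mul_of_nonneg_right ?_ (Real.sqrt_nonneg _)
    exact Real.sqrt_le_iff.mpr ⟨by linarith, by nlinarith⟩
  have hsqh : Real.sqrt (h : ℝ) ≤ X ^ (1 + δ / 2) := by
    calc Real.sqrt (h : ℝ) ≤ Real.sqrt (X ^ (2 + δ)) := Real.sqrt_le_sqrt hhX
      _ = X ^ (1 + δ / 2) := by
          rw [Real.sqrt_eq_rpow, ← Real.rpow_mul hX0.le]; ring_nf
  have h1 : X ^ (-δ) ≤ a * Xj / Real.sqrt ((a * h : ℕ) : ℝ) := by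
    rw [le_div_iff₀ hs0]
    calc X ^ (-δ) * Real.sqrt ((a * h : ℕ) : ℝ) ≤ X ^ (-(δ / 2)) * (a * Real.sqrt h) :=
          mul_le_mul (Real.rpow_le_rpow_of_exponent_le hX (by linarith)) hsah hs0.le (Real.rpow_nonneg hX0.le _)
      _ = a * (X ^ (-(δ / 2)) * Real.sqrt h) := by ring
      _ ≤ a * (X ^ (-(δ / 2)) * X ^ (1 + δ / 2)) :=
          mul_le_mul_of_nonneg_left (mul_le_mul_of_nonneg_left hsqh (Real.rpow_nonneg hX0.le _)) (by positivity)
      _ = a * X := by rw [← Real.rpow_add hX0]; ring_nf; rw [Real.rpow_one]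
      _ ≤ a * Xj := mul_le_mul_of_nonneg_left hXj (by positivity)
  have h2 : X ^ (-δ) / 2 < X ^ (-δ) := by
    have : 0 < X ^ (-δ) := Real.rpow_pos_of_pos hX0 _
    linarith
  exact h2.trans_le h1

/-- **`Z₀(X_j) ≤ (X_j/X) · 2a · lastFactor`** (`Z₀(X_j) = max(1, (2𝐗_j/𝐘 + 1)/(Z₁Z₂))`). [cite: GrimmeltMerikoski2025, §5 (choice of Z₀)] -/
theorem Z0j_le {a h : ℕ} (ha : 0 < a) (hh : 0 < h) {X D K Xj : ℝ} (hX : 1 ≤ X) (hD : 1 ≤ D) (hK : 0 < K)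
    (hXj : X ≤ Xj) :
    max 1 ((2 * ((Xj / K) / (Real.sqrt ((a * h : ℕ) : ℝ) / (a * K))) + 1) /
      (D * (1 + D / Real.sqrt ((a * h : ℕ) : ℝ)))) ≤ (Xj / X) * (2 * a * lastFactor X D h) := by
  have hX0 : 0 < X := by linarith
  have ha0 : (0 : ℝ) < a := by exact_mod_cast ha
  have hahr : ((a * h : ℕ) : ℝ) = (a : ℝ) * h := by push_cast; ring
  have hs0 : 0 < Real.sqrt ((a * h : ℕ) : ℝ) := Real.sqrt_pos.mpr (by rw [hahr]; positivity)
  have hρ1 : 1 ≤ Xj / X := by rw [le_div_iff₀ hX0]; linarith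
  have hbase := Z0_le ha hh hX hD
  have hZZ : 0 < D * (1 + D / Real.sqrt ((a * h : ℕ) : ℝ)) := by positivity
  have hKne : K ≠ 0 := hK.ne'
  have hr_eq : ∀ Y : ℝ, (Y / K) / (Real.sqrt ((a * h : ℕ) : ℝ) / (a * K)) = a * Y / Real.sqrt ((a * h : ℕ) : ℝ) := by
    intro Y; field_simp
  have hL0 : 0 < 2 * a * lastFactor X D h := by
    have := one_le_lastFactor (hh := (h : ℝ)) hX0.le (by linarith : (0 : ℝ) < D); positivity
  refine max_le ?_ ?_
  · calc (1 : ℝ) ≤ 1 * (2 * a * lastFactor X D h) := by rw [one_mul]; exact (le_max_left _ _).trans hbase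
      _ ≤ (Xj / X) * (2 * a * lastFactor X D h) := mul_le_mul_of_nonneg_right hρ1 hL0.le
  · rw [hr_eq]
    have e1 : a * Xj / Real.sqrt ((a * h : ℕ) : ℝ) = (Xj / X) * (a * X / Real.sqrt ((a * h : ℕ) : ℝ)) := by
      field_simp
    have hr0 : 0 ≤ a * X / Real.sqrt ((a * h : ℕ) : ℝ) := by positivity
    have hnum : 2 * (a * Xj / Real.sqrt ((a * h : ℕ) : ℝ)) + 1 ≤
        (Xj / X) * (2 * (a * X / Real.sqrt ((a * h : ℕ) : ℝ)) + 1) := by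
      rw [e1]; nlinarith
    have hb2 : (2 * ((a : ℝ) * X / Real.sqrt ((a * h : ℕ) : ℝ)) + 1) / (D * (1 + D / Real.sqrt ((a * h : ℕ) : ℝ))) ≤
        2 * a * lastFactor X D h := (le_max_right _ _).trans hbase
    calc (2 * (a * Xj / Real.sqrt ((a * h : ℕ) : ℝ)) + 1) / (D * (1 + D / Real.sqrt ((a * h : ℕ) : ℝ)))
        ≤ ((Xj / X) * (2 * (a * X / Real.sqrt ((a * h : ℕ) : ℝ)) + 1)) / (D * (1 + D / Real.sqrt ((a * h : ℕ) : ℝ))) :=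
          div_le_div_of_nonneg_right hnum hZZ.le
      _ = (Xj / X) * ((2 * (a * X / Real.sqrt ((a * h : ℕ) : ℝ)) + 1) / (D * (1 + D / Real.sqrt ((a * h : ℕ) : ℝ)))) := by
          ring
      _ ≤ (Xj / X) * (2 * a * lastFactor X D h) := mul_le_mul_of_nonneg_left hb2 (by positivity)

/-- `2r + 1 ≤ Z₀ Z₁ Z₂` for `Z₀ = max(1, (2r+1)/(Z₁Z₂))`. [folklore] -/
theorem Zcond_of_max {r P : ℝ} (hP : 0 < P) : 2 * r + 1 ≤ max 1 ((2 * r + 1) / P) * P := by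
  calc 2 * r + 1 = (2 * r + 1) / P * P := by field_simp
    _ ≤ max 1 ((2 * r + 1) / P) * P := mul_le_mul_of_nonneg_right (le_max_right _ _) hP.le

/-- **The first scale `𝐗 = X/K`**: `X/K ≤ X^{3ε₁}` and `K/X ≤ 2 D X^{ε₁}` in the regime
`X^{1-ε₁} ≤ K ≤ D X^{1+δ}`, `δ ≤ ε₁`. [cite: GrimmeltMerikoski2025, §5 ("K > X^{1-η}" and "K ≤ DX^{1+η}")] -/
theorem sX1_bounds {X K D δ ε₁ : ℝ} (hX : 1 ≤ X) (hD : 1 ≤ D) (hε₁ : 0 < ε₁) (hδε : δ ≤ ε₁)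
    (hKlo : X ^ (1 - ε₁) ≤ K) (hKD : K ≤ D * X ^ (1 + δ)) :
    X / K ≤ X ^ (3 * ε₁) ∧ (X / K)⁻¹ ≤ 2 * D * X ^ ε₁ := by
  have hX0 : 0 < X := by linarith
  constructor
  · have h1 : X / K ≤ X / X ^ (1 - ε₁) := div_le_div_of_nonneg_left hX0.le (Real.rpow_pos_of_pos hX0 _) hKlo
    have h2 : X / X ^ (1 - ε₁) = X ^ ε₁ := by
      rw [div_eq_iff (Real.rpow_pos_of_pos hX0 _).ne', ← Real.rpow_add hX0]; ring_nf; rw [Real.rpow_one]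
    rw [h2] at h1
    exact h1.trans (Real.rpow_le_rpow_of_exponent_le hX (by linarith))
  · rw [inv_div, div_le_iff₀ hX0]
    have e : D * X ^ (1 + δ) = D * X ^ δ * X := by rw [Real.rpow_add hX0, Real.rpow_one]; ring
    have hXδε : X ^ δ ≤ X ^ ε₁ := Real.rpow_le_rpow_of_exponent_le hX hδε
    have hXδ0 : 0 ≤ X ^ δ := Real.rpow_nonneg hX0.le _
    calc K ≤ D * X ^ δ * X := by rw [← e]; exact hKD
      _ ≤ D * X ^ ε₁ * X := by
          refine mul_le_mul_of_nonneg_right (mul_le_mul_of_nonneg_left hXδε (by linarith)) hX0.le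
      _ ≤ 2 * D * X ^ ε₁ * X := by
          have : 0 ≤ D * X ^ ε₁ * X := by positivity
          linarith

/-- `D² ≤ X` from `D ≤ X^{1/2}`. [folklore] -/
theorem sq_le_of_le_rpow_half {D X : ℝ} (hD : 0 ≤ D) (hX : 0 ≤ X) (h : D ≤ X ^ (1 / 2 : ℝ)) : D ^ 2 ≤ X := by
  have := pow_le_pow_left₀ hD h 2
  rwa [← Real.sqrt_eq_rpow, Real.sq_sqrt hX] at this

/-- **The final arithmetic**: `B²·(2M X^{23ε₁} 𝓑) + 1 ≤ X^{ε₀} 𝓑` when `B² ≤ X^{2ε₁}`, `2M + 1 ≤ X^{ε₁}`,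
`26 ε₁ ≤ ε₀`, `𝓑 ≥ 1`, `X ≥ 1`. [folklore] -/
theorem final_arith {X B M 𝓑 ε₀ ε₁ : ℝ} (hX : 1 ≤ X) (hε₁ : 0 ≤ ε₁) (hM : 0 ≤ M) (h𝓑 : 1 ≤ 𝓑)
    (hB2 : B ^ 2 ≤ X ^ (2 * ε₁)) (hMX : 2 * M + 1 ≤ X ^ ε₁) (hε : 26 * ε₁ ≤ ε₀) :
    B ^ 2 * (2 * M * X ^ (23 * ε₁) * 𝓑) + 1 ≤ X ^ ε₀ * 𝓑 := by
  have hX0 : 0 < X := by linarith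
  have hX23 : 0 ≤ X ^ (23 * ε₁) := Real.rpow_nonneg hX0.le _
  have hX25 : 1 ≤ X ^ (25 * ε₁) := Real.one_le_rpow hX (by positivity)
  have e25 : X ^ (2 * ε₁) * X ^ (23 * ε₁) = X ^ (25 * ε₁) := by rw [← Real.rpow_add hX0]; ring_nf
  have e26 : X ^ ε₁ * X ^ (25 * ε₁) = X ^ (26 * ε₁) := by rw [← Real.rpow_add hX0]; ring_nf
  have h26 : X ^ (26 * ε₁) ≤ X ^ ε₀ := Real.rpow_le_rpow_of_exponent_le hX hε
  have h𝓑0 : 0 ≤ 𝓑 := by linarith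
  calc B ^ 2 * (2 * M * X ^ (23 * ε₁) * 𝓑) + 1
      ≤ X ^ (2 * ε₁) * (2 * M * X ^ (23 * ε₁) * 𝓑) + 1 :=
        add_le_add (mul_le_mul_of_nonneg_right hB2 (by positivity)) le_rfl
    _ = 2 * M * X ^ (25 * ε₁) * 𝓑 + 1 := by rw [← e25]; ring
    _ ≤ 2 * M * X ^ (25 * ε₁) * 𝓑 + X ^ (25 * ε₁) * 𝓑 := by
        refine add_le_add le_rfl ?_
        nlinarith
    _ = (2 * M + 1) * X ^ (25 * ε₁) * 𝓑 := by ring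
    _ ≤ X ^ ε₁ * X ^ (25 * ε₁) * 𝓑 :=
        mul_le_mul_of_nonneg_right (mul_le_mul_of_nonneg_right hMX (by linarith)) h𝓑0
    _ = X ^ (26 * ε₁) * 𝓑 := by rw [e26]
    _ ≤ X ^ ε₀ * 𝓑 := mul_le_mul_of_nonneg_right h26 h𝓑0

set_option maxHeartbeats 1600000 in
/-- **Theorem 1.4 of [GrimmeltMerikoski2025] in the restricted range, from the hypothesis schema.**
Given the content of [GrimmeltMerikoski2025, Theorem 2.1] (= [GMtechnical, Thm 8.1]) in the form
`TechnicalDatum (7/64)`, the named fact `grimmeltMerikoski2025_thm14_restricted` holds.  The proof is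
§5 of the paper: the Poisson range `K ≤ X^{1-η}` (`grimmeltMerikoski2025_thm14_poissonRange`);
otherwise `X₂ = K^{1/(1-η)}`, reduction to the difference of the two smoothed sums
(`typeISum_le_diffForm_add`), the parametrisation by Heegner points and orbit sums (Lemma 3.1,
`sum_forms_eq_sum_heegPairs`) with cancelling main terms (`integral_skewTestFun_xStretch`),
Theorem 2.1 for each `d`, Cauchy–Schwarz in `d`, Proposition 4.2 (`exists_sum_kernelDiagSum_le`) for
`K₁` and Proposition 4.1 (`heegnerKernel_sum_le`, `kernelSide_le`) for `K₂`, with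
`Z₁ = D`, `Z₂ = 1 + D/√(ah)`, `Z₀ = max(1, (2𝐗/𝐘 + 1)/(Z₁Z₂))`.
[cite: GrimmeltMerikoski2025, §5 (Proof of Theorem 1.4) and Theorem 2.1] -/
theorem thm14_restricted_of_technicalDatum (𝒟 : TechnicalDatum (7 / 64 : ℝ)) :
    grimmeltMerikoski2025_thm14_restricted := by
  classical
  intro ε hε
  -- exponents
  obtain ⟨ε₀, hε₀, hε₀1, hε₀ε⟩ : ∃ ε₀ : ℝ, 0 < ε₀ ∧ ε₀ ≤ 1 ∧ ε₀ ≤ ε :=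
    ⟨min ε 1, lt_min hε one_pos, min_le_right _ _, min_le_left _ _⟩
  obtain ⟨ε₁, hε₁def⟩ : ∃ ε₁ : ℝ, ε₁ = ε₀ / 64 := ⟨_, rfl⟩
  have hε₁ : 0 < ε₁ := by rw [hε₁def]; positivity
  have hε₁4 : ε₁ ≤ 1 / 4 := by rw [hε₁def]; linarith
  have hε₁3 : ε₁ ≤ 1 / 3 := by linarith
  have h26 : 26 * ε₁ ≤ ε₀ := by rw [hε₁def]; linarith
  -- the data
  obtain ⟨J₀, C, A, hC, hA, hB⟩ := 𝒟.bound ε₁ hε₁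
  obtain ⟨δ₁, hδ₁, J₁, X₁, hS0⟩ := grimmeltMerikoski2025_thm14_poissonRange ε₁ hε₁ ε₀ hε₀
  obtain ⟨C₃, hC₃, hC₃b⟩ := exists_sum_kernelDiagSum_le hε₁
  obtain ⟨K₄, hK₄, hK₄b⟩ := heegnerKernel_sum_le hε₁
  -- parameters `δ`, `J`, `X₀`
  obtain ⟨δ, hδ0, hδδ₁, hδA, hδε₁⟩ : ∃ δ : ℝ, 0 < δ ∧ δ ≤ δ₁ ∧ δ * A ≤ ε₁ ∧ δ ≤ ε₁ := by
    refine ⟨min δ₁ (ε₁ / (A + 1)), lt_min hδ₁ (by positivity), min_le_left _ _, ?_, ?_⟩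
    · have h1 : min δ₁ (ε₁ / (A + 1)) ≤ ε₁ / (A + 1) := min_le_right _ _
      rw [le_div_iff₀ (by positivity)] at h1
      have h0 : 0 ≤ min δ₁ (ε₁ / (A + 1)) := (lt_min hδ₁ (by positivity)).le
      nlinarith
    · exact (min_le_right _ _).trans (div_le_self hε₁.le (by linarith))
  obtain ⟨J, hJJ₀, hJJ₁, hJ2, hJε⟩ : ∃ J : ℕ, J₀ ≤ J ∧ J₁ ≤ J ∧ 2 ≤ J ∧ 8 ≤ ε₁ * ((J - 1 : ℕ) : ℝ) := by
    refine ⟨max (max J₀ J₁) (⌈8 / ε₁⌉₊ + 2), (le_max_left _ _).trans (le_max_left _ _),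
      (le_max_right _ _).trans (le_max_left _ _), le_trans (by omega) (le_max_right _ _), ?_⟩
    have h1 : (8 / ε₁ : ℝ) ≤ ⌈8 / ε₁⌉₊ := Nat.le_ceil _
    have h2 : (⌈8 / ε₁⌉₊ : ℝ) ≤ ((max (max J₀ J₁) (⌈8 / ε₁⌉₊ + 2) - 1 : ℕ) : ℝ) := by
      have : ⌈8 / ε₁⌉₊ ≤ max (max J₀ J₁) (⌈8 / ε₁⌉₊ + 2) - 1 := by
        have := le_max_right (max J₀ J₁) (⌈8 / ε₁⌉₊ + 2); omega
      exact_mod_cast this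
    have h3 := h1.trans h2
    rw [div_le_iff₀ hε₁] at h3; linarith
  set E₀ : ℝ := (2 : ℝ) ^ A with hE₀def
  have hE₀1 : 1 ≤ E₀ := Real.one_le_rpow (by norm_num) hA.le
  set M : ℝ := 2 * C * E₀ * Real.sqrt (5 * C₃) * Real.sqrt (2 * K₄) with hMdef
  have hM0 : 0 ≤ M := by positivity
  refine ⟨δ, hδ0, J, max (max X₁ ((2 : ℝ) ^ (J + 2))) ((2 * M + 1) ^ (1 / ε₁)), ?_⟩
  intro X hX D K hD1 hDK hKX2 hKD hDX h hh1 hhsq hhX a ha1 haX hah ψ₁ ψ₂ hψ₁ hψ₂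
  -- basic facts about `X`
  have hXX₁ : X₁ ≤ X := le_trans ((le_max_left _ _).trans (le_max_left _ _)) hX
  have hXJ : (2 : ℝ) ^ (J + 2) ≤ X := le_trans ((le_max_right _ _).trans (le_max_left _ _)) hX
  have hXM : (2 * M + 1) ^ (1 / ε₁) ≤ X := le_trans (le_max_right _ _) hX
  have hX2 : (2 : ℝ) ≤ X := by
    refine le_trans ?_ hXJ
    calc (2 : ℝ) = 2 ^ 1 := by norm_num
      _ ≤ 2 ^ (J + 2) := pow_le_pow_right₀ (by norm_num) (by omega)
  have hX1 : (1 : ℝ) ≤ X := by linarith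
  have hX0 : (0 : ℝ) < X := by linarith
  have hh0 : 0 < h := hh1
  have ha0 : 0 < a := ha1
  have ha1r : (1 : ℝ) ≤ a := by exact_mod_cast ha1
  have hh1r : (1 : ℝ) ≤ h := by exact_mod_cast hh1
  have hK0 : (0 : ℝ) < K := by linarith
  have hD0 : (0 : ℝ) < D := by linarith
  have hDXs : D ^ 2 ≤ X := sq_le_of_le_rpow_half hD0.le hX0.le hDX
  have hDX' : D ≤ X := by nlinarith
  -- the target bound
  have h𝓑eq := bound_eq X D h
  have hL1 : 1 ≤ lastFactor X D h := one_le_lastFactor hX0.le hD0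
  have h𝓑1 := one_le_bound h hX1 hD1
  generalize h𝓑def : D ^ (1 / 2 : ℝ) * X ^ (1 / 2 : ℝ) * (D ^ (1 / 2 : ℝ) + (h : ℝ) ^ (1 / 4 : ℝ)) *
    (1 + X / (D * (D + (h : ℝ) ^ (1 / 2 : ℝ)))) ^ (7 / 64 : ℝ) = 𝓑 at h𝓑eq
  rw [h𝓑eq] at h𝓑1
  have h𝓑0 : 0 ≤ 𝓑 := by linarith
  -- monotonicity in the exponent at the very end
  suffices hmain : typeISum a h ψ₁ ψ₂ X K D ≤ X ^ ε₀ * 𝓑 from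
    hmain.trans (mul_le_mul_of_nonneg_right (Real.rpow_le_rpow_of_exponent_le hX1 hε₀ε) h𝓑0)
  ------------------------------------------------------------------
  -- Regime 1: the Poisson range `K ≤ X^{1-ε₁}`
  ------------------------------------------------------------------
  by_cases hKsmall : K ≤ X ^ (1 - ε₁)
  · have hXδ : X ^ δ ≤ X ^ δ₁ := Real.rpow_le_rpow_of_exponent_le hX1 hδδ₁
    have := hS0 X hXX₁ D K hD1 hDK hKX2 hKsmall hDX h hh1 hhsq
      (hhX.trans (Real.rpow_le_rpow_of_exponent_le hX1 (by linarith))) a ha1 (haX.trans hXδ) hah ψ₁ ψ₂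
      ((hψ₁.of_le hJJ₁).mono hXδ) ((hψ₂.of_le hJJ₁).mono hXδ)
    rwa [h𝓑def] at this
  ------------------------------------------------------------------
  -- Regime 2: `X^{1-ε₁} < K`.  The second scale `X₂ = K^{1/(1-ε₁)}`.
  ------------------------------------------------------------------
  have hKlo : X ^ (1 - ε₁) ≤ K := (not_le.mp hKsmall).le
  obtain ⟨hXX₂, hX₂4, hs2lo, hs2hi, ht2⟩ := X2_facts hX1 hε₁ hε₁3 hKlo hKX2
  generalize hX₂def : K ^ (1 / (1 - ε₁)) = X₂ at hXX₂ hX₂4 hs2lo hs2hi ht2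
  have hX₂0 : 0 < X₂ := by linarith
  have hc0 : 0 < X / X₂ := div_pos hX0 hX₂0
  have hc1 : X / X₂ ≤ 1 := (div_le_one hX₂0).mpr hXX₂
  -- normalised weights `Ψᵢ = ψᵢ / X^δ`
  have hB0 : 0 < X ^ δ := Real.rpow_pos_of_pos hX0 _
  have hBX : X ^ δ ≤ X := by
    calc X ^ δ ≤ X ^ (1 : ℝ) := Real.rpow_le_rpow_of_exponent_le hX1 (by linarith)
      _ = X := Real.rpow_one X
  have hB2 : (X ^ δ) ^ 2 ≤ X ^ (2 * ε₁) := by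
    rw [← Real.rpow_natCast, ← Real.rpow_mul hX0.le]
    exact Real.rpow_le_rpow_of_exponent_le hX1 (by push_cast; nlinarith)
  set Ψ₁ : ℝ → ℂ := fun u => ψ₁ u / ((X ^ δ : ℝ) : ℂ) with hΨ₁def
  set Ψ₂ : ℝ → ℂ := fun u => ψ₂ u / ((X ^ δ : ℝ) : ℂ) with hΨ₂def
  -- `δ₀ = X^{-δ}/2`
  have hXδpos : 0 < X ^ (-δ) := Real.rpow_pos_of_pos hX0 _
  have hδ₀0 : 0 < X ^ (-δ) / 2 := by positivity
  have hδ₀1 : X ^ (-δ) / 2 ≤ 1 := by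
    have : X ^ (-δ) ≤ 1 := Real.rpow_le_one_of_one_le_of_nonpos hX1 (by linarith)
    linarith
  have hΨ₁w : IsDeltaWeight Ψ₁ 1 2 J₀ (X ^ (-δ) / 2) := isDeltaWeight_div (hψ₁.of_le hJJ₀) hB0 hδ₀0 hδ₀1
  have hΨ₂w : IsDeltaWeight Ψ₂ (-1) 1 J₀ (X ^ (-δ) / 2) := isDeltaWeight_div (hψ₂.of_le hJJ₀) hB0 hδ₀0 hδ₀1
  -- `E = δ₀^{-A} ≤ 2^A X^{ε₁}`
  have hE : (X ^ (-δ) / 2) ^ (-A) ≤ E₀ * X ^ ε₁ := by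
    have e : (X ^ (-δ) / 2) ^ (-A) = (2 : ℝ) ^ A * X ^ (δ * A) := by
      rw [div_eq_mul_inv, Real.mul_rpow hXδpos.le (by norm_num), ← Real.rpow_mul hX0.le,
        Real.inv_rpow (by norm_num), ← Real.rpow_neg_one, ← Real.rpow_mul (by norm_num)]
      ring_nf
    rw [e]
    exact mul_le_mul_of_nonneg_left (Real.rpow_le_rpow_of_exponent_le hX1 hδA) (by positivity)
  have hE0 : 0 ≤ (X ^ (-δ) / 2) ^ (-A) := Real.rpow_nonneg hδ₀0.le _
  ------------------------------------------------------------------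
  -- Step 1: `typeISum ≤ DF + Err`, `Err ≤ 1`
  ------------------------------------------------------------------
  have hS1 := typeISum_le_diffForm_add hψ₁ hψ₂ hJ2 a h hX0 hX₂0 hK0 D
  have hErr : (⌊D⌋₊ : ℝ) * (2 * K) * (X ^ δ * ((X / X₂) * (2 * X ^ δ * (2 * K) * ((2 * K) / X₂) ^ (J - 1)))) ≤ 1 :=
    poissonErr_le_one hX2 (Nat.floor_le hD0.le) hDX' hK0.le hKX2 hB0.le hBX hc0.le hc1 (by positivity) ht2 hJε hXJ
  ------------------------------------------------------------------
  -- Step 2: the difference form through `Ψ`, per modulus (Lemma 3.1 + cancelling main terms)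
  ------------------------------------------------------------------
  set sY : ℝ := Real.sqrt ((a * h : ℕ) : ℝ) / (a * K) with hsYdef
  set Φ : ℝ → ℍ → ℂ := fun Xj => skewTestFun Ψ₁ (fun s => Ψ₂ (-s)) (Xj / K) sY with hΦdef
  set T : ℕ → ℝ → ℂ := fun d Xj => ∑ w ∈ (heegPairs a h d).image pairPt,
    ((∑ p ∈ (heegPairs a h d).filter (fun p => pairPt p = w), pairWt p : ℝ) : ℂ) *
      (orbitSum (Gamma0GL (a * d)) (Φ Xj) w - (𝒟.m (a * d) : ℂ) * ∫ z : ℍ, Φ Xj z) with hTdef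
  have hBC : ((X ^ δ : ℝ) : ℂ) ≠ 0 := by exact_mod_cast hB0.ne'
  have hscale : ∀ k : ℕ, ψ₁ ((k : ℝ) / K) * (rootSum a h k ψ₂ X - ((X / X₂ : ℝ) : ℂ) * rootSum a h k ψ₂ X₂) =
      ((X ^ δ : ℝ) : ℂ) ^ 2 * (Ψ₁ ((k : ℝ) / K) * (rootSum a h k Ψ₂ X - ((X / X₂ : ℝ) : ℂ) * rootSum a h k Ψ₂ X₂)) := by
    intro k
    simp only [hΨ₁def, hΨ₂def, rootSum_div]
    field_simp
  have hDF : ∀ d ∈ Icc 1 ⌊D⌋₊, ‖∑ k ∈ (Icc 1 ⌊2 * K⌋₊).filter (fun k : ℕ => d ∣ k),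
      ψ₁ ((k : ℝ) / K) * (rootSum a h k ψ₂ X - ((X / X₂ : ℝ) : ℂ) * rootSum a h k ψ₂ X₂)‖ ≤
      (X ^ δ) ^ 2 * (‖T d X‖ + (X / X₂) * ‖T d X₂‖) := by
    intro d hd
    rw [mem_Icc] at hd
    haveI : NeZero (a * d) := ⟨(Nat.mul_pos ha0 hd.1).ne'⟩
    have e : ∑ k ∈ (Icc 1 ⌊2 * K⌋₊).filter (fun k : ℕ => d ∣ k),
        ψ₁ ((k : ℝ) / K) * (rootSum a h k ψ₂ X - ((X / X₂ : ℝ) : ℂ) * rootSum a h k ψ₂ X₂) =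
        ((X ^ δ : ℝ) : ℂ) ^ 2 * ∑ k ∈ (Icc 1 ⌊2 * K⌋₊).filter (fun k : ℕ => d ∣ k),
          Ψ₁ ((k : ℝ) / K) * (rootSum a h k Ψ₂ X - ((X / X₂ : ℝ) : ℂ) * rootSum a h k Ψ₂ X₂) := by
      rw [mul_sum]
      exact sum_congr rfl fun k _ => hscale k
    rw [e, norm_mul, norm_pow, Complex.norm_real, Real.norm_eq_abs, abs_of_pos hB0]
    refine mul_le_mul_of_nonneg_left ?_ (by positivity)
    exact diffTerm_le ha0 hh0 Ψ₁ Ψ₂ hΨ₁w.2.1 hΨ₂w.2.1 hK0 hX0 hX₂0 (𝒟.m (a * d))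
  ------------------------------------------------------------------
  -- Step 3: Theorem 2.1 summed over `d`, with the `Z`'s of §5
  ------------------------------------------------------------------
  have hsY0 : 0 < sY := by
    rw [hsYdef]
    have : (0 : ℝ) < ((a * h : ℕ) : ℝ) := by exact_mod_cast Nat.mul_pos ha0 hh0
    have : (0 : ℝ) < a := by exact_mod_cast ha0
    positivity
  have hZ₂1 : (1 : ℝ) ≤ 1 + D / Real.sqrt ((a * h : ℕ) : ℝ) := by
    have : 0 ≤ D / Real.sqrt ((a * h : ℕ) : ℝ) := by positivity
    linarith
  have hZZ : 0 < D * (1 + D / Real.sqrt ((a * h : ℕ) : ℝ)) := by positivity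
  have hsumErr : ∀ Xj : ℝ, ∀ hXj : X ≤ Xj,
      ∑ d ∈ Icc 1 ⌊D⌋₊, ‖T d Xj‖ ≤
        C * ((a * ⌊D⌋₊ : ℕ) : ℝ) ^ ε₁ * (X ^ (-δ) / 2) ^ (-A) * ((Xj / K) / sY) ^ (1 / 2 : ℝ) *
          (1 + (Xj / K) / sY) ^ ε₁ *
          (max 1 ((2 * ((Xj / K) / sY) + 1) / (D * (1 + D / Real.sqrt ((a * h : ℕ) : ℝ))))) ^ (7 / 64 : ℝ) *
          Real.sqrt (∑ d ∈ Icc 1 ⌊D⌋₊, automorphicKernel (Gamma0GL (a * d)) (kPlus (D ^ 2))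
            (iPt (Xj / K) (div_pos (hX0.trans_le hXj) hK0)) (iPt (Xj / K) (div_pos (hX0.trans_le hXj) hK0))) *
          Real.sqrt (∑ d ∈ Icc 1 ⌊D⌋₊, ∑ p ∈ heegPairs a h d, ∑ p' ∈ heegPairs a h d,
            pairWt p * pairWt p' * automorphicKernel (Gamma0GL (a * d))
              (kPlus ((1 + D / Real.sqrt ((a * h : ℕ) : ℝ)) ^ 2)) (pairPt p') (pairPt p)) := by
    intro Xj hXj
    have hXj0 : 0 < Xj := by linarith
    have hδr : X ^ (-δ) / 2 < (Xj / K) / sY := delta0_lt_ratio ha0 hh0 hX1 hδ0 hhX hXj hK0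
    have hZc : 2 * ((Xj / K) / sY) + 1 ≤
        max 1 ((2 * ((Xj / K) / sY) + 1) / (D * (1 + D / Real.sqrt ((a * h : ℕ) : ℝ)))) * D *
          (1 + D / Real.sqrt ((a * h : ℕ) : ℝ)) := by
      have := Zcond_of_max (r := (Xj / K) / sY) hZZ
      rwa [← mul_assoc] at this
    have hZc' : 2 * (Xj / K) / sY + 1 ≤
        max 1 ((2 * ((Xj / K) / sY) + 1) / (D * (1 + D / Real.sqrt ((a * h : ℕ) : ℝ)))) * D *
          (1 + D / Real.sqrt ((a * h : ℕ) : ℝ)) := by rwa [mul_div_assoc]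
    exact sum_errors_le ha0 hh0 hC hε₁ 𝒟.m hB hΨ₁w hΨ₂w hδ₀0 hδ₀1 hK0 hXj0 hδr (le_max_left _ _) hD1 hZ₂1
      hZc' ⌊D⌋₊
  ------------------------------------------------------------------
  -- Step 4: the kernel sums (Propositions 4.2 and 4.1)
  ------------------------------------------------------------------
  have hDn1 : 1 ≤ ⌊D⌋₊ := Nat.le_floor (by simpa using hD1)
  have hDn : (⌊D⌋₊ : ℝ) ≤ D := Nat.floor_le hD0.le
  have haε : (a : ℝ) ≤ X ^ ε₁ := haX.trans (Real.rpow_le_rpow_of_exponent_le hX1 hδε₁)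
  have hK1b : ∀ Xj : ℝ, ∀ hXj0 : 0 < Xj / K, Xj / K ≤ X ^ (3 * ε₁) → (Xj / K)⁻¹ ≤ 2 * D * X ^ ε₁ →
      ∑ d ∈ Icc 1 ⌊D⌋₊, automorphicKernel (Gamma0GL (a * d)) (kPlus (D ^ 2)) (iPt (Xj / K) hXj0) (iPt (Xj / K) hXj0) ≤
        5 * C₃ * X ^ (11 * ε₁) * D := by
    intro Xj hXj0 hs1 hs2
    refine (sum_K1_le ha0 hXj0 hD1 hC₃b ⌊D⌋₊).trans ?_
    have := K1_bookkeeping hX2 hD1 hDXs (Nat.cast_nonneg ⌊D⌋₊) hDn (by positivity) haε hε₁ hε₁4 hXj0 hs1 hs2 hC₃.le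
    push_cast at this ⊢
    exact this
  have hK2b : ∑ d ∈ Icc 1 ⌊D⌋₊, ∑ p ∈ heegPairs a h d, ∑ p' ∈ heegPairs a h d,
      pairWt p * pairWt p' * automorphicKernel (Gamma0GL (a * d))
        (kPlus ((1 + D / Real.sqrt ((a * h : ℕ) : ℝ)) ^ 2)) (pairPt p') (pairPt p) ≤
      2 * K₄ * X ^ (15 * ε₁) * (D * Real.sqrt h + h) := by
    refine (sum_K2_le ha0 hh0 hZ₂1 (hK₄b a h ha0 hh0 hhsq hah) hDn1).trans ?_
    have hh3 : (h : ℝ) ≤ X ^ 3 := hhX.trans (by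
      calc X ^ (2 + δ) ≤ X ^ (3 : ℝ) := Real.rpow_le_rpow_of_exponent_le hX1 (by linarith)
        _ = X ^ 3 := by rw [show (3 : ℝ) = ((3 : ℕ) : ℝ) by norm_num, Real.rpow_natCast])
    have hDn1r : (1 : ℝ) ≤ ⌊D⌋₊ := by exact_mod_cast hDn1
    have hahr : ((a * h : ℕ) : ℝ) = (a : ℝ) * h := by push_cast; ring
    have := K2_bookkeeping hX2 hD1 hDXs hDn1r hDn ha1r haε hh1r hh3 hε₁ hε₁4 hK₄.le
    rw [hahr]
    push_cast at this ⊢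
    exact this
  ------------------------------------------------------------------
  -- Step 5: the product bound for `X_j ∈ {X, X₂}` (`product_bookkeeping`)
  ------------------------------------------------------------------
  have hQ : (((a * ⌊D⌋₊ : ℕ) : ℝ)) ^ ε₁ ≤ X ^ ε₁ := by
    refine Real.rpow_le_rpow (Nat.cast_nonneg _) ?_ hε₁.le
    push_cast
    calc (a : ℝ) * ⌊D⌋₊ ≤ X ^ δ * X ^ (1 / 2 : ℝ) := mul_le_mul haX (hDn.trans hDX) (Nat.cast_nonneg _) hB0.le
      _ = X ^ (δ + 1 / 2) := by rw [← Real.rpow_add hX0]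
      _ ≤ X ^ (1 : ℝ) := Real.rpow_le_rpow_of_exponent_le hX1 (by linarith)
      _ = X := Real.rpow_one X
  have hr_eq : ∀ Xj : ℝ, (Xj / K) / sY = a * Xj / Real.sqrt ((a * h : ℕ) : ℝ) := by
    intro Xj; rw [hsYdef]; field_simp
  have hahr' : Real.sqrt ((a * h : ℕ) : ℝ) = Real.sqrt ((a : ℝ) * h) := by push_cast; ring_nf
  have hprod : ∀ Xj : ℝ, X ≤ Xj → Xj ≤ X ^ 4 → Xj / K ≤ X ^ (3 * ε₁) → (Xj / K)⁻¹ ≤ 2 * D * X ^ ε₁ →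
      (X / Xj) * ∑ d ∈ Icc 1 ⌊D⌋₊, ‖T d Xj‖ ≤ M * X ^ (23 * ε₁) * 𝓑 := by
    intro Xj hXj hXj4 hs1 hs2
    have hXj0 : 0 < Xj := by linarith
    have h1 := hsumErr Xj hXj
    have hK1 := hK1b Xj (div_pos hXj0 hK0) hs1 hs2
    have hZ₀le := Z0j_le (D := D) ha0 hh0 hX1 hD1 hK0 hXj
    have hpb := product_bookkeeping (C := C) (Q := (((a * ⌊D⌋₊ : ℕ) : ℝ)) ^ ε₁) (E := (X ^ (-δ) / 2) ^ (-A))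
      (E₀ := E₀) hX2 hXj hXj4 ha1r haε hh1r hD1 hL1 hε₁ hε₁4 hC.le (Real.rpow_nonneg (Nat.cast_nonneg _) _)
      hQ hE0 hE₀1 hE hC₃.le hK₄.le hK1 hK2b (le_trans zero_le_one (le_max_left _ _)) hZ₀le
    rw [h𝓑eq, ← hMdef] at hpb
    have hr_eq2 : (a : ℝ) * Xj / Real.sqrt ((a : ℝ) * h) = (Xj / K) / sY := by rw [← hahr', ← hr_eq]
    rw [hr_eq2, Real.sqrt_eq_rpow ((Xj / K) / sY)] at hpb
    refine le_trans ?_ hpb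
    exact mul_le_mul_of_nonneg_left h1 (div_pos hX0 hXj0).le
  ------------------------------------------------------------------
  -- Step 6: assemble
  ------------------------------------------------------------------
  obtain ⟨hsX1, hsX1'⟩ := sX1_bounds hX1 hD1 hε₁ hδε₁ hKlo hKD
  have hsX2' : (X₂ / K)⁻¹ ≤ 2 * D * X ^ ε₁ := by
    have h1 : (X₂ / K)⁻¹ ≤ 1 := inv_le_one_of_one_le₀ hs2lo
    have h2 : (1 : ℝ) ≤ 2 * D * X ^ ε₁ := by
      have h3 : 1 ≤ X ^ ε₁ := Real.one_le_rpow hX1 hε₁.le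
      nlinarith
    linarith
  have hXX4 : X ≤ X ^ 4 := by
    calc X = X ^ 1 := (pow_one X).symm
      _ ≤ X ^ 4 := pow_le_pow_right₀ hX1 (by norm_num)
  have hP1 := hprod X le_rfl hXX4 hsX1 hsX1'
  rw [div_self hX0.ne', one_mul] at hP1
  have hP2 := hprod X₂ hXX₂ hX₂4 hs2hi hsX2'
  have hDFsum : ∑ d ∈ Icc 1 ⌊D⌋₊, ‖∑ k ∈ (Icc 1 ⌊2 * K⌋₊).filter (fun k : ℕ => d ∣ k),
      ψ₁ ((k : ℝ) / K) * (rootSum a h k ψ₂ X - ((X / X₂ : ℝ) : ℂ) * rootSum a h k ψ₂ X₂)‖ ≤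
      (X ^ δ) ^ 2 * (2 * M * X ^ (23 * ε₁) * 𝓑) := by
    calc _ ≤ ∑ d ∈ Icc 1 ⌊D⌋₊, (X ^ δ) ^ 2 * (‖T d X‖ + (X / X₂) * ‖T d X₂‖) := sum_le_sum hDF
      _ = (X ^ δ) ^ 2 * (∑ d ∈ Icc 1 ⌊D⌋₊, ‖T d X‖ + (X / X₂) * ∑ d ∈ Icc 1 ⌊D⌋₊, ‖T d X₂‖) := by
          rw [← mul_sum, sum_add_distrib, mul_sum]
      _ ≤ (X ^ δ) ^ 2 * (M * X ^ (23 * ε₁) * 𝓑 + M * X ^ (23 * ε₁) * 𝓑) :=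
          mul_le_mul_of_nonneg_left (add_le_add hP1 hP2) (by positivity)
      _ = _ := by ring
  have hMX : 2 * M + 1 ≤ X ^ ε₁ := by
    have h0 : 0 ≤ 2 * M + 1 := by positivity
    calc 2 * M + 1 = ((2 * M + 1) ^ (1 / ε₁)) ^ ε₁ := by
          rw [← Real.rpow_mul h0, one_div_mul_cancel hε₁.ne', Real.rpow_one]
      _ ≤ X ^ ε₁ := Real.rpow_le_rpow (Real.rpow_nonneg h0 _) hXM hε₁.le
  calc typeISum a h ψ₁ ψ₂ X K D ≤ (X ^ δ) ^ 2 * (2 * M * X ^ (23 * ε₁) * 𝓑) + 1 :=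
        hS1.trans (add_le_add hDFsum hErr)
    _ ≤ X ^ ε₀ * 𝓑 := final_arith hX1 hε₁.le hM0 h𝓑1 hB2 hMX h26

end finalAssembly

end GM2025

/-- **Theorem 1.4 of [GrimmeltMerikoski2025] (restricted range) from the hypothesis schema** — the
root-namespace form of `GM2025.thm14_restricted_of_technicalDatum`: an inhabitant of
`GM2025.TechnicalDatum (7/64)` (the content of [GrimmeltMerikoski2025, Theorem 2.1] with the
Kim–Sarnak exponent) yields the named fact `grimmeltMerikoski2025_thm14_restricted`.
[cite: GrimmeltMerikoski2025, §5 (Proof of Theorem 1.4)] -/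
theorem grimmeltMerikoski2025_thm14_restricted_of_technicalDatum
    (𝒟 : GM2025.TechnicalDatum (7 / 64 : ℝ)) : grimmeltMerikoski2025_thm14_restricted :=
  GM2025.thm14_restricted_of_technicalDatum 𝒟

end Literature.NumberTheory.Sieve

end
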